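import Literature.Analysis.FunctionSpaces.SpinorWightman

/-!
# The two-fold cover `SL(2, ℂ) → L↑₊` and the reduction of scalar multiplets (proofs)

Trunk `AnalysisL` (G28), companion to `Literature.Analysis.FunctionSpaces.SpinorWightman`.
That file vendors, as named facts (`def … : Prop`), the standard properties of the
correspondence `A ↦ Λ(A)`, `(Λ(A) x)̰ = A x̰ Aᴴ` (Streater–Wightman §1-3) and the reduction
`IsSpinorWightmanQFT.toWightman` of hermitian scalar multiplets to the accepted scalar Wightman
axioms `IsWightmanQFT`. This file discharges all of them:

* `spinActFun_mul_holds` (`Λ(AB) = Λ(A)Λ(B)`, SW eq. (1-15)), from Pauli completeness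
  `sum_pauli_smul_eq_of_isHermitian` and `toHermitian_spinActFun : (Λ(A) x)̰ = A x̰ Aᴴ`;
* `exists_restrictedLorentz_coe_eq_spinActFun_holds` (`Λ(A) ∈ L↑₊`): `Λ(A)` is bundled as the
  continuous linear automorphism `spinLorentz A`; it preserves `η` (`det x̰ = η(x, x)`), is
  orthochronous (`(Λ(A) e₀)⁰ = ½ tr (A Aᴴ) > 0`, `spinActFun_e₀_zero`) and proper: a Lorentz
  transformation has `det = ±1` (`det_sq_eq_one_of_mem_lorentzGroup`), every generator of
  `SL(2, ℂ)` (transvections, `diag(c, c⁻¹)`; Mathlib's `diagonal_transvection_induction'`) is a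
  square `B²`, and `det Λ(B²) = (det Λ(B))² = 1` — this replaces SW's continuity argument;
* `spinActFun_eq_iff_holds` (the kernel is `{±1}`, SW §1-3 "left to the reader");
* `spinActFun_surjective_holds` (onto `L↑₊`, SW eq. (1-15) and the sentence after it), by the
  explicit decomposition `Λ = Λ(A₁) Λ(A₂) Λ(A₃)`: the hermitian boost
  `A₁ = (ṽ + 1)/√(2(v⁰ + 1))`, `v = Λ e₀`, takes `e₀` to `v`; the rotation
  `A₂ = i (n⃗ + e₃)·σ/√(2(1 + n³)) ∈ SU(2)` takes `e₃` to the unit spatial vector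
  `n = Λ(A₁)⁻¹ Λ e₃`; the residual transformation fixes `e₀`, `e₃`, hence (orthogonality and
  `det = 1`) is a rotation in the `(1, 2)`-plane, equal to `Λ(diag(α, ᾱ))` with `α² = u¹ − iu²`;
* the covering homomorphism `spinCoverHom : SL(2, ℂ) →* L↑₊` is continuous and **proper**
  (`isProperMap_spinCoverHom`: `A ↦ (Λ(A) e₀)⁰ = ½ ∑ |A_{ij}|²` is a proper function), hence a
  closed quotient map, which transfers strong continuity from `A ↦ U(0, A)` to the descended
  representation of `L↑₊`;
* `IsSpinorWightmanQFT.toWightman_holds`: for one-component multiplets with `S = 1` and Bose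
  statistics, `U(0, −1)` commutes with all fields (W2') and fixes `Ω`, so it is the identity on
  the dense span of field monomials applied to `Ω` (W4), i.e. `U(0, −1) = 1`; therefore
  `U(0, A)` depends on `A` only through `Λ(A)` and descends to a unitary representation `lor` of
  `L↑₊` (well defined by the kernel, a homomorphism by multiplicativity, everywhere defined by
  surjectivity, strongly continuous by the quotient-map property); the remaining Wightman
  axioms and the Wightman functions transfer verbatim.

## Sources

R. F. Streater, A. S. Wightman, *PCT, Spin and Statistics, and All That* (1964; Princeton 2000
printing, pp. 12–13), §1-3, eqs. (1-11)–(1-15): `x̰`, `det x̰ = x²`, `Λ(A)`, `Λ(−A) = Λ(A)`,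
"if `Λ(A) = Λ(B)` then `A = ±B`", "`A → Λ(A)` is a homomorphism of `SL(2, ℂ)` onto `L↑₊`";
§3-1, pp. 86–88, eqs. (3-1)–(3-4) and example (a) (scalar field, `S(A) = 1`).

## Mathlib

Used: `Matrix.SpecialLinearGroup.diagonal_transvection_induction'`, `transvection_add`,
`diag2n`, `IsAlgClosed.exists_pow_nat_eq` (complex square roots), `LinearMap.toMatrix`,
`LinearMap.det_toMatrix`, `Matrix.det_succ_row_zero`, `Matrix.det_fin_three`,
`PiLp.basisFun`, `continuous_clm_apply` (finite-dimensional operator-norm continuity),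
`isProperMap_of_comp_of_t2`, `isProperMap_iff_isCompact_preimage`,
`IsProperMap.isClosedMap`, `IsClosedMap.isQuotientMap`, `IsQuotientMap.continuous_iff`,
`Matrix.SpecialLinearGroup.isClosedEmbedding_val`, `T2Space.of_injective_continuous`,
`ContinuousLinearMap.ext_on` (operators agreeing on a set with dense span).
-/

noncomputable section

open Filter Topology ComplexConjugate Matrix Complex
open scoped InnerProductSpace SchwartzMap MatrixGroups

namespace Literature.Analysis.FunctionSpaces

/-! ### Pauli matrices and `x ↦ x̰` -/

/-- `σ₁ = !![0, 1; 1, 0]` (unfolding of `pauliMatrix`; Streater–Wightman (1964), §1-3, eq. (1-11)). [cite: StreaterWightman1964] -/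
theorem pauliMatrix_one_eq : pauliMatrix 1 = !![0, 1; 1, 0] := rfl

/-- `σ₂ = !![0, -i; i, 0]` (unfolding of `pauliMatrix`; Streater–Wightman (1964), §1-3, eq. (1-11)). [cite: StreaterWightman1964] -/
theorem pauliMatrix_two_eq : pauliMatrix 2 = !![0, -I; I, 0] := rfl

/-- `σ₃ = !![1, 0; 0, -1]` (unfolding of `pauliMatrix`; Streater–Wightman (1964), §1-3, eq. (1-11)). [cite: StreaterWightman1964] -/
theorem pauliMatrix_three_eq : pauliMatrix 3 = !![1, 0; 0, -1] := rfl

/-- Entries of `x̰ = !![x⁰ + x³, x¹ − i x²; x¹ + i x², x⁰ − x³]` (Streater–Wightman (1964), §1-3,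
eq. (1-11)). [cite: StreaterWightman1964] -/
theorem toHermitian_eq (x : Literature.MathematicalPhysics.QuantumLattice.SpaceTime 3) :
    toHermitian x =
      !![(x 0 : ℂ) + x 3, (x 1 : ℂ) - I * x 2; (x 1 : ℂ) + I * x 2, (x 0 : ℂ) - x 3] := by
  rw [toHermitian_apply]
  ext i j
  fin_cases i <;> fin_cases j <;>
    simp [Fin.sum_univ_four, Matrix.smul_apply, pauliMatrix_one_eq, pauliMatrix_two_eq,
      pauliMatrix_three_eq] <;> ring

/-- Pauli completeness: a Hermitian `2 × 2` matrix `Y` is recovered from its Pauli components,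
`Y = ∑_μ (½ Re tr(σ_μ Y)) σ_μ` (Streater–Wightman (1964), §1-3, eq. (1-12): `x^μ = ½ tr (X τ^μ)`
for hermitian `X`). [cite: StreaterWightman1964] -/
theorem sum_pauli_smul_eq_of_isHermitian {Y : Matrix (Fin 2) (Fin 2) ℂ} (hY : Y.IsHermitian) :
    ∑ μ : Fin 4, (2⁻¹ * ((pauliMatrix μ * Y).trace).re) • pauliMatrix μ = Y := by
  have h00 : (Y 0 0).im = 0 := by
    have := congrFun (congrFun hY.eq 0) 0
    simp only [conjTranspose_apply, RCLike.star_def] at this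
    have h2 := congrArg Complex.im this
    simp at h2; linarith
  have h11 : (Y 1 1).im = 0 := by
    have := congrFun (congrFun hY.eq 1) 1
    simp only [conjTranspose_apply, RCLike.star_def] at this
    have h2 := congrArg Complex.im this
    simp at h2; linarith
  have h10 : Y 1 0 = conj (Y 0 1) := by
    have := congrFun (congrFun hY.eq 1) 0
    simpa only [conjTranspose_apply, RCLike.star_def] using this.symm
  ext i j
  fin_cases i <;> fin_cases j <;>
    simp [Fin.sum_univ_four, Matrix.smul_apply, pauliMatrix_one_eq, pauliMatrix_two_eq,
      pauliMatrix_three_eq, Matrix.trace, Fin.sum_univ_two, Matrix.mul_apply, h10] <;>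
    apply Complex.ext <;> simp [h00, h11] <;> ring

/-- `x ↦ x̰` is injective (Streater–Wightman (1964), §1-3, eq. (1-12)). [cite: StreaterWightman1964] -/
theorem toHermitian_injective : Function.Injective (toHermitian : Literature.MathematicalPhysics.QuantumLattice.SpaceTime 3 → _) := by
  intro x y h
  rw [toHermitian_eq, toHermitian_eq] at h
  have e00 := congrArg (fun M : Matrix (Fin 2) (Fin 2) ℂ => (M 0 0).re) h
  have e11 := congrArg (fun M : Matrix (Fin 2) (Fin 2) ℂ => (M 1 1).re) h
  have e10 := congrArg (fun M : Matrix (Fin 2) (Fin 2) ℂ => (M 1 0).re) h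
  have e10' := congrArg (fun M : Matrix (Fin 2) (Fin 2) ℂ => (M 1 0).im) h
  simp at e00 e11 e10 e10'
  ext μ
  fin_cases μ <;> simp <;> linarith

/-- The defining property of `Λ(A)`: `(Λ(A) x)̰ = A x̰ Aᴴ` (Streater–Wightman (1964), §1-3,
eq. (1-14)). [cite: StreaterWightman1964] -/
theorem toHermitian_spinActFun (A : SL(2, ℂ)) (x : Literature.MathematicalPhysics.QuantumLattice.SpaceTime 3) :
    toHermitian (spinActFun A x) =
      (A : Matrix (Fin 2) (Fin 2) ℂ) * toHermitian x * (A : Matrix (Fin 2) (Fin 2) ℂ)ᴴ := by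
  have hY : ((A : Matrix (Fin 2) (Fin 2) ℂ) * toHermitian x *
      (A : Matrix (Fin 2) (Fin 2) ℂ)ᴴ).IsHermitian :=
    Matrix.isHermitian_mul_mul_conjTranspose _ (isHermitian_toHermitian x)
  rw [toHermitian_apply]
  simp_rw [spinActFun_apply]
  exact sum_pauli_smul_eq_of_isHermitian hY

/-- Discharge of the named fact `spinActFun_mul`: `Λ(AB) = Λ(A) ∘ Λ(B)` (Streater–Wightman (1964),
§1-3, eq. (1-15)), from `(Λ(A) x)̰ = A x̰ Aᴴ` and injectivity of `x ↦ x̰`. [cite: StreaterWightman1964] -/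
theorem spinActFun_mul_holds : spinActFun_mul := by
  intro A B
  funext x
  apply toHermitian_injective
  simp only [Function.comp_apply, toHermitian_spinActFun, Matrix.SpecialLinearGroup.coe_mul,
    Matrix.conjTranspose_mul, Matrix.mul_assoc]



variable {d : ℕ}

/-! ### Lorentz transformations have determinant `±1` -/

/-- The signature vector `g = (1, -1, …, -1)` of the Minkowski form (Streater–Wightman (1964), §1-1,
eq. (1-1)). [cite: StreaterWightman1964] -/
private def sgnVec (d : ℕ) (k : Fin (d + 1)) : ℝ := if k = 0 then 1 else -1

/-- `η(x, y) = ∑_k x^k g_k y^k` with `g = (1, −1, …, −1)` (Streater–Wightman (1964), §1-1, eq. (1-1)). [cite: StreaterWightman1964] -/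
theorem minkowskiForm_eq_sum_sgnVec (x y : Literature.MathematicalPhysics.QuantumLattice.SpaceTime d) :
    Literature.MathematicalPhysics.QuantumLattice.minkowskiForm d x y = ∑ k, x k * sgnVec d k * y k := by
  rw [Literature.MathematicalPhysics.QuantumLattice.minkowskiForm_apply, Fin.sum_univ_succ]
  simp only [sgnVec, if_true, Fin.succ_ne_zero, if_false, mul_one, mul_neg_one, neg_mul,
    Finset.sum_neg_distrib, sub_eq_add_neg]

/-- A Lorentz transformation has determinant `±1`: `(det Λ)² = 1` (Streater–Wightman (1964), §1-1,
eq. (1-3): `Λᵀ G Λ = G`, so `(det Λ)² = 1`). [cite: StreaterWightman1964] -/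
theorem det_sq_eq_one_of_mem_lorentzGroup {Λ : Literature.MathematicalPhysics.QuantumLattice.SpaceTime d ≃L[ℝ] Literature.MathematicalPhysics.QuantumLattice.SpaceTime d}
    (h : Λ ∈ Literature.MathematicalPhysics.QuantumLattice.lorentzGroup d) :
    LinearMap.det ((Λ : Literature.MathematicalPhysics.QuantumLattice.SpaceTime d →L[ℝ] Literature.MathematicalPhysics.QuantumLattice.SpaceTime d) : Literature.MathematicalPhysics.QuantumLattice.SpaceTime d →ₗ[ℝ] Literature.MathematicalPhysics.QuantumLattice.SpaceTime d) ^ 2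
      = 1 := by
  classical
  set b : Module.Basis (Fin (d + 1)) ℝ (Literature.MathematicalPhysics.QuantumLattice.SpaceTime d) := PiLp.basisFun 2 ℝ (Fin (d + 1)) with hb
  set f : Literature.MathematicalPhysics.QuantumLattice.SpaceTime d →ₗ[ℝ] Literature.MathematicalPhysics.QuantumLattice.SpaceTime d :=
    ((Λ : Literature.MathematicalPhysics.QuantumLattice.SpaceTime d →L[ℝ] Literature.MathematicalPhysics.QuantumLattice.SpaceTime d) : Literature.MathematicalPhysics.QuantumLattice.SpaceTime d →ₗ[ℝ] Literature.MathematicalPhysics.QuantumLattice.SpaceTime d) with hf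
  set M := LinearMap.toMatrix b b f with hM
  have hM_apply : ∀ k i, M k i = Λ (b i) k := fun k i => by
    rw [hM, LinearMap.toMatrix_apply, hb, PiLp.basisFun_repr]
    rfl
  have hb_apply : ∀ (i k : Fin (d + 1)), b i k = if k = i then 1 else 0 := fun i k => by
    rw [hb, PiLp.basisFun_apply, PiLp.single_apply]
  -- the matrix identity `Mᵀ G M = G`
  have key : Mᵀ * diagonal (sgnVec d) * M = diagonal (sgnVec d) := by
    ext i j
    have hij := h (b i) (b j)
    rw [minkowskiForm_eq_sum_sgnVec, minkowskiForm_eq_sum_sgnVec] at hij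
    rw [Matrix.mul_apply]
    simp only [Matrix.mul_diagonal, Matrix.transpose_apply, diagonal_apply, hM_apply]
    rw [hij]
    simp only [hb_apply, ite_mul, one_mul, zero_mul, mul_ite, mul_one, mul_zero,
      Finset.sum_ite_eq', Finset.mem_univ, if_true]
    by_cases hij' : i = j
    · subst hij'; simp
    · simp [hij', Ne.symm hij']
  have hdetg : (diagonal (sgnVec d)).det ≠ 0 := by
    rw [det_diagonal]
    refine Finset.prod_ne_zero_iff.2 fun i _ => ?_
    simp only [sgnVec]; split_ifs <;> norm_num
  have hdet := congrArg Matrix.det key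
  rw [det_mul, det_mul, det_transpose] at hdet
  have hM2 : M.det ^ 2 = 1 := by
    have : (M.det ^ 2 - 1) * (diagonal (sgnVec d)).det = 0 := by linear_combination hdet
    rcases mul_eq_zero.1 this with h1 | h1
    · linear_combination h1
    · exact absurd h1 hdetg
  rwa [hM, LinearMap.det_toMatrix] at hM2

/-- A Lorentz transformation has determinant `1` or `-1` (Streater–Wightman (1964), §1-1, eq. (1-3)). [cite: StreaterWightman1964] -/
theorem det_eq_one_or_of_mem_lorentzGroup {Λ : Literature.MathematicalPhysics.QuantumLattice.SpaceTime d ≃L[ℝ] Literature.MathematicalPhysics.QuantumLattice.SpaceTime d}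
    (h : Λ ∈ Literature.MathematicalPhysics.QuantumLattice.lorentzGroup d) :
    LinearMap.det ((Λ : Literature.MathematicalPhysics.QuantumLattice.SpaceTime d →L[ℝ] Literature.MathematicalPhysics.QuantumLattice.SpaceTime d) : Literature.MathematicalPhysics.QuantumLattice.SpaceTime d →ₗ[ℝ] Literature.MathematicalPhysics.QuantumLattice.SpaceTime d) = 1 ∨
    LinearMap.det ((Λ : Literature.MathematicalPhysics.QuantumLattice.SpaceTime d →L[ℝ] Literature.MathematicalPhysics.QuantumLattice.SpaceTime d) : Literature.MathematicalPhysics.QuantumLattice.SpaceTime d →ₗ[ℝ] Literature.MathematicalPhysics.QuantumLattice.SpaceTime d) = -1 :=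
  mul_self_eq_one_iff.1 (by rw [← sq]; exact det_sq_eq_one_of_mem_lorentzGroup h)


/-! ### `Λ(A)` is a restricted Lorentz transformation -/

/-- `Λ(A)` as a real-linear map of space-time: `x ↦ Λ(A) x` is real linear since `x ↦ x̰` is
(Streater–Wightman (1964), §1-3, eq. (1-14): "a real linear mapping of four-vectors"). [cite: StreaterWightman1964] -/
def spinActLin (A : SL(2, ℂ)) : Literature.MathematicalPhysics.QuantumLattice.SpaceTime 3 →ₗ[ℝ] Literature.MathematicalPhysics.QuantumLattice.SpaceTime 3 where
  toFun := spinActFun A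
  map_add' x y := by
    ext μ
    simp only [spinActFun_apply, map_add, Matrix.mul_add, Matrix.add_mul, Matrix.trace_add,
      Complex.add_re, PiLp.add_apply]
    ring
  map_smul' c x := by
    ext μ
    simp only [spinActFun_apply, LinearMap.map_smul, Matrix.mul_smul, Matrix.smul_mul,
      Matrix.trace_smul, PiLp.smul_apply, smul_eq_mul, RingHom.id_apply, Complex.smul_re]
    ring

/-- Unfolding of `spinActLin`. [folklore] -/
@[simp]
theorem spinActLin_apply (A : SL(2, ℂ)) (x : Literature.MathematicalPhysics.QuantumLattice.SpaceTime 3) : spinActLin A x = spinActFun A x := rfl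

/-- `Λ(A⁻¹) (Λ(A) x) = x` (from `Λ(A⁻¹A) = Λ(1) = id`; Streater–Wightman (1964), §1-3, eq. (1-15)). [cite: StreaterWightman1964] -/
theorem spinActFun_inv_apply (A : SL(2, ℂ)) (x : Literature.MathematicalPhysics.QuantumLattice.SpaceTime 3) :
    spinActFun A⁻¹ (spinActFun A x) = x := by
  rw [← Function.comp_apply (f := spinActFun A⁻¹), ← spinActFun_mul_holds, inv_mul_cancel,
    spinActFun_one, id]

/-- `Λ(A) (Λ(A⁻¹) x) = x` (Streater–Wightman (1964), §1-3, eq. (1-15)). [cite: StreaterWightman1964] -/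
theorem spinActFun_apply_inv (A : SL(2, ℂ)) (x : Literature.MathematicalPhysics.QuantumLattice.SpaceTime 3) :
    spinActFun A (spinActFun A⁻¹ x) = x := by
  rw [← Function.comp_apply (f := spinActFun A), ← spinActFun_mul_holds, mul_inv_cancel,
    spinActFun_one, id]

/-- `Λ(A)` as a continuous linear automorphism of space-time, with inverse `Λ(A⁻¹)`
(Streater–Wightman (1964), §1-3, eqs. (1-14)–(1-15)). [cite: StreaterWightman1964] -/
def spinLorentz (A : SL(2, ℂ)) : Literature.MathematicalPhysics.QuantumLattice.SpaceTime 3 ≃L[ℝ] Literature.MathematicalPhysics.QuantumLattice.SpaceTime 3 :=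
  ContinuousLinearEquiv.equivOfInverse (LinearMap.toContinuousLinearMap (spinActLin A))
    (LinearMap.toContinuousLinearMap (spinActLin A⁻¹))
    (spinActFun_inv_apply A) (spinActFun_apply_inv A)

/-- `⇑(spinLorentz A) = spinActFun A` (unfolding). [folklore] -/
@[simp]
theorem coe_spinLorentz (A : SL(2, ℂ)) : ⇑(spinLorentz A) = spinActFun A := rfl

/-- `spinLorentz A x = spinActFun A x` (unfolding). [folklore] -/
theorem spinLorentz_apply (A : SL(2, ℂ)) (x : Literature.MathematicalPhysics.QuantumLattice.SpaceTime 3) : spinLorentz A x = spinActFun A x := rfl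

/-- `A ↦ Λ(A)` is multiplicative: `Λ(AB) = Λ(A) Λ(B)` (Streater–Wightman (1964), §1-3, eq. (1-15)). [cite: StreaterWightman1964] -/
theorem spinLorentz_mul (A B : SL(2, ℂ)) : spinLorentz (A * B) = spinLorentz A * spinLorentz B := by
  apply ContinuousLinearEquiv.ext
  rw [coe_spinLorentz, spinActFun_mul_holds]
  rfl

/-- `Λ(1) = 1` as automorphisms (Streater–Wightman (1964), §1-3, eq. (1-15)). [cite: StreaterWightman1964] -/
theorem spinLorentz_one : spinLorentz 1 = 1 := by
  apply ContinuousLinearEquiv.ext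
  rw [coe_spinLorentz, spinActFun_one]
  rfl

/-- `Λ(−A) = Λ(A)` as automorphisms (Streater–Wightman (1964), §1-3). [cite: StreaterWightman1964] -/
theorem spinLorentz_neg (A : SL(2, ℂ)) : spinLorentz (-A) = spinLorentz A := by
  apply ContinuousLinearEquiv.ext
  rw [coe_spinLorentz, coe_spinLorentz, spinActFun_neg]

/-- `Λ(A)` preserves the Minkowski quadratic form: `η(Λ(A)x, Λ(A)x) = η(x, x)`, since
`det (A x̰ Aᴴ) = det x̰ = η(x, x)` (Streater–Wightman (1964), §1-3, eqs. (1-13)–(1-14)). [cite: StreaterWightman1964] -/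
theorem minkowskiForm_spinActFun_self (A : SL(2, ℂ)) (x : Literature.MathematicalPhysics.QuantumLattice.SpaceTime 3) :
    Literature.MathematicalPhysics.QuantumLattice.minkowskiForm 3 (spinActFun A x) (spinActFun A x) = Literature.MathematicalPhysics.QuantumLattice.minkowskiForm 3 x x := by
  have h := det_toHermitian (spinActFun A x)
  rw [toHermitian_spinActFun, det_mul, det_mul, det_conjTranspose, A.det_coe, star_one, one_mul,
    mul_one, det_toHermitian] at h
  exact_mod_cast h.symm

/-- `Λ(A)` is a Lorentz transformation (polarisation of `minkowskiForm_spinActFun_self`;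
Streater–Wightman (1964), §1-3, after eq. (1-14)). [cite: StreaterWightman1964] -/
theorem spinLorentz_mem_lorentzGroup (A : SL(2, ℂ)) : spinLorentz A ∈ Literature.MathematicalPhysics.QuantumLattice.lorentzGroup 3 := by
  intro x y
  have hx := minkowskiForm_spinActFun_self A x
  have hy := minkowskiForm_spinActFun_self A y
  have hxy := minkowskiForm_spinActFun_self A (x + y)
  have hadd : spinActFun A (x + y) = spinActFun A x + spinActFun A y := map_add (spinActLin A) x y
  rw [hadd] at hxy
  simp only [map_add, _root_.add_apply] at hxy
  rw [Literature.MathematicalPhysics.QuantumLattice.minkowskiForm_comm (spinActFun A y) (spinActFun A x), Literature.MathematicalPhysics.QuantumLattice.minkowskiForm_comm y x] at hxy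
  rw [coe_spinLorentz]
  linarith

/-- `(e₀)̰ = 1 = σ₀` (Streater–Wightman (1964), §1-3, eq. (1-11)). [cite: StreaterWightman1964] -/
theorem toHermitian_e₀ : toHermitian (Literature.MathematicalPhysics.QuantumLattice.e₀ 3) = 1 := by
  rw [toHermitian_eq]
  ext i j
  fin_cases i <;> fin_cases j <;> simp

/-- `(Λ(A) e₀)⁰ = ½ tr (A Aᴴ) = ½ ∑ |A_{ij}|²` (Streater–Wightman (1964), §1-3, remark on the trace of
eq. (1-14)). [cite: StreaterWightman1964] -/
theorem spinActFun_e₀_zero (A : SL(2, ℂ)) :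
    spinActFun A (Literature.MathematicalPhysics.QuantumLattice.e₀ 3) 0 =
      2⁻¹ * ∑ i, ∑ j, Complex.normSq ((A : Matrix (Fin 2) (Fin 2) ℂ) i j) := by
  rw [spinActFun_apply, toHermitian_e₀, pauliMatrix_zero, Matrix.mul_one, Matrix.one_mul]
  congr 1
  simp only [Matrix.trace, Matrix.diag, Matrix.mul_apply, conjTranspose_apply, RCLike.star_def,
    Complex.mul_conj, ← Complex.ofReal_sum, Complex.ofReal_re]

/-- `∑ |A_{ij}|² > 0` for `A ∈ SL(2, ℂ)` (`A ≠ 0` since `det A = 1`). [folklore] -/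
theorem sum_normSq_coe_pos (A : SL(2, ℂ)) :
    0 < ∑ i, ∑ j, Complex.normSq ((A : Matrix (Fin 2) (Fin 2) ℂ) i j) := by
  by_contra hle
  push Not at hle
  have hnn : ∀ i, 0 ≤ ∑ j, normSq ((A : Matrix (Fin 2) (Fin 2) ℂ) i j) :=
    fun i => Finset.sum_nonneg fun j _ => normSq_nonneg _
  have h0 : ∑ i, ∑ j, normSq ((A : Matrix (Fin 2) (Fin 2) ℂ) i j) = 0 :=
    le_antisymm hle (Finset.sum_nonneg fun i _ => hnn i)
  have hall : ∀ i j, (A : Matrix (Fin 2) (Fin 2) ℂ) i j = 0 := by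
    intro i j
    have hi := (Finset.sum_eq_zero_iff_of_nonneg (fun i _ => hnn i)).1 h0 i (Finset.mem_univ _)
    have hij := (Finset.sum_eq_zero_iff_of_nonneg (fun j _ => normSq_nonneg _)).1 hi j
      (Finset.mem_univ _)
    exact Complex.normSq_eq_zero.1 hij
  have := A.det_coe
  rw [Matrix.det_fin_two, hall, hall, hall, hall] at this
  norm_num at this

/-- `Λ(A)` is orthochronous: `(Λ(A) e₀)⁰ = ½ ∑ |A_{ij}|² > 0` (Streater–Wightman (1964), §1-3:
`Λ(A) ∈ L↑₊`). [cite: StreaterWightman1964] -/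
theorem isOrthochronous_spinLorentz (A : SL(2, ℂ)) : Literature.MathematicalPhysics.QuantumLattice.IsOrthochronous (spinLorentz A) := by
  unfold Literature.MathematicalPhysics.QuantumLattice.IsOrthochronous
  rw [spinLorentz_apply, spinActFun_e₀_zero]
  exact mul_pos (by norm_num) (sum_normSq_coe_pos A)

/-- `Λ(A)` is proper: every generator of `SL(2, ℂ)` (transvections, `diag(c, c⁻¹)`) is a square,
and `det Λ(B²) = (det Λ(B))² = 1` since `det Λ(B) = ±1` (this replaces the continuity argument of
Streater–Wightman (1964), §1-3: "we can vary `A` continuously until it is the identity"). [cite: StreaterWightman1964] -/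
theorem isProper_spinLorentz (A : SL(2, ℂ)) : Literature.MathematicalPhysics.QuantumLattice.IsProper (spinLorentz A) := by
  have hmul : ∀ A B : SL(2, ℂ), Literature.MathematicalPhysics.QuantumLattice.IsProper (spinLorentz A) → Literature.MathematicalPhysics.QuantumLattice.IsProper (spinLorentz B) →
      Literature.MathematicalPhysics.QuantumLattice.IsProper (spinLorentz (A * B)) := by
    intro A B hA hB
    rw [Literature.MathematicalPhysics.QuantumLattice.isProper_iff_mem_ker] at *
    rw [spinLorentz_mul]
    exact Subgroup.mul_mem _ hA hB
  have hsq : ∀ B : SL(2, ℂ), Literature.MathematicalPhysics.QuantumLattice.IsProper (spinLorentz (B * B)) := by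
    intro B
    rw [spinLorentz_mul, Literature.MathematicalPhysics.QuantumLattice.isProper_iff_mem_ker, MonoidHom.mem_ker, map_mul, Literature.MathematicalPhysics.QuantumLattice.detHom_apply]
    rcases det_eq_one_or_of_mem_lorentzGroup (spinLorentz_mem_lorentzGroup B) with h | h <;>
      rw [h] <;> norm_num
  refine Matrix.SpecialLinearGroup.diagonal_transvection_induction'
    (fun A => Literature.MathematicalPhysics.QuantumLattice.IsProper (spinLorentz A)) A ?_ ?_ hmul
  · intro i j hij c hc
    obtain ⟨z, hz⟩ := IsAlgClosed.exists_pow_nat_eq c (n := 2) two_pos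
    have hz0 : z ≠ 0 := by
      rintro rfl
      exact hc (by simpa using hz.symm)
    have : Matrix.SpecialLinearGroup.diag2n hij c hc =
        Matrix.SpecialLinearGroup.diag2n hij z hz0 *
          Matrix.SpecialLinearGroup.diag2n hij z hz0 := by
      apply Subtype.ext
      change (Matrix.SpecialLinearGroup.diag2n hij c hc).1 =
        (Matrix.SpecialLinearGroup.diag2n hij z hz0).1 *
          (Matrix.SpecialLinearGroup.diag2n hij z hz0).1
      simp only [Matrix.SpecialLinearGroup.diag2n_coe, diagonal_mul_diagonal]
      congr 1
      funext k
      split_ifs <;> simp [← hz, sq]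
    rw [this]
    exact hsq _
  · intro i j hij a
    rw [show a = a / 2 + a / 2 by ring, Matrix.SpecialLinearGroup.transvection_add]
    exact hsq _

/-- `Λ(A) ∈ L↑₊` (Streater–Wightman (1964), §1-3: "`Λ(A)` is a restricted Lorentz transformation"). [cite: StreaterWightman1964] -/
theorem spinLorentz_mem_restrictedLorentzGroup (A : SL(2, ℂ)) :
    spinLorentz A ∈ Literature.MathematicalPhysics.QuantumLattice.restrictedLorentzGroup 3 :=
  (Literature.MathematicalPhysics.QuantumLattice.mem_restrictedLorentzGroup_iff _).2
    ⟨spinLorentz_mem_lorentzGroup A, isOrthochronous_spinLorentz A, isProper_spinLorentz A⟩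

/-- Discharge of the named fact `exists_restrictedLorentz_coe_eq_spinActFun`: `Λ(A)` is (the coercion
of) a restricted Lorentz transformation (Streater–Wightman (1964), §1-3). [cite: StreaterWightman1964] -/
theorem exists_restrictedLorentz_coe_eq_spinActFun_holds :
    exists_restrictedLorentz_coe_eq_spinActFun :=
  fun A => ⟨spinLorentz A, spinLorentz_mem_restrictedLorentzGroup A, rfl⟩

/-! ### The kernel of `A ↦ Λ(A)` is `{±1}` -/

/-- `(e_μ)̰ = σ_μ` for `e_μ = EuclideanSpace.single μ 1` (Streater–Wightman (1964), §1-3,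
eq. (1-11)). [cite: StreaterWightman1964] -/
theorem toHermitian_single (μ : Fin 4) :
    toHermitian (EuclideanSpace.single μ (1 : ℝ)) = pauliMatrix μ := by
  rw [toHermitian_apply]
  simp [ite_smul, Finset.sum_ite_eq']

/-- Discharge of the named fact `spinActFun_eq_iff`: `Λ(A) = Λ(B) ↔ A = ±B` (Streater–Wightman (1964),
§1-3: "It is left to the reader to verify that if `Λ(A) = Λ(B)` then `A = ±B`"). Proof: `C = B⁻¹A`
satisfies `C X Cᴴ = X` for all hermitian `X`; `X = 1` gives `C` unitary, so `C` commutes with the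
Pauli matrices, hence is scalar, and `det C = 1` forces `C = ±1`. [cite: StreaterWightman1964] -/
theorem spinActFun_eq_iff_holds : spinActFun_eq_iff := by
  intro A B
  constructor
  swap
  · rintro (rfl | rfl)
    · rfl
    · exact spinActFun_neg B
  intro h
  set M := (A : Matrix (Fin 2) (Fin 2) ℂ) with hM
  set N := (B : Matrix (Fin 2) (Fin 2) ℂ) with hN
  have key : ∀ μ : Fin 4, M * pauliMatrix μ * Mᴴ = N * pauliMatrix μ * Nᴴ := fun μ => by
    rw [← toHermitian_single, ← toHermitian_spinActFun, ← toHermitian_spinActFun, h]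
  have hadjN : adjugate N * N = 1 := by
    rw [adjugate_mul, hN, B.det_coe, one_smul]
  have hNadj : N * adjugate N = 1 := by
    rw [mul_adjugate, hN, B.det_coe, one_smul]
  set C := adjugate N * M with hC
  have hdetC : C.det = 1 := by
    rw [hC, det_mul, det_adjugate, hN, hM, A.det_coe, B.det_coe]
    simp
  have hσ : ∀ μ : Fin 4, C * pauliMatrix μ * Cᴴ = pauliMatrix μ := fun μ => by
    have e1 : C * pauliMatrix μ * Cᴴ = adjugate N * (M * pauliMatrix μ * Mᴴ) * (adjugate N)ᴴ := by
      simp only [hC, conjTranspose_mul, Matrix.mul_assoc]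
    rw [e1, key μ]
    have e2 : adjugate N * (N * pauliMatrix μ * Nᴴ) * (adjugate N)ᴴ =
        (adjugate N * N) * pauliMatrix μ * (adjugate N * N)ᴴ := by
      simp only [conjTranspose_mul, Matrix.mul_assoc]
    rw [e2, hadjN, conjTranspose_one, Matrix.one_mul, Matrix.mul_one]
  have hCC : C * Cᴴ = 1 := by simpa using hσ 0
  have hCC' : Cᴴ * C = 1 := mul_eq_one_comm.1 hCC
  have hcomm : ∀ μ : Fin 4, C * pauliMatrix μ = pauliMatrix μ * C := fun μ => by
    calc C * pauliMatrix μ = C * pauliMatrix μ * (Cᴴ * C) := by rw [hCC', Matrix.mul_one]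
      _ = (C * pauliMatrix μ * Cᴴ) * C := by simp only [Matrix.mul_assoc]
      _ = pauliMatrix μ * C := by rw [hσ μ]
  -- entries
  have h3 := hcomm 3
  have h1 := hcomm 1
  rw [pauliMatrix_three_eq] at h3
  rw [pauliMatrix_one_eq] at h1
  have e01 := congrFun (congrFun h3 0) 1
  have e10 := congrFun (congrFun h3 1) 0
  have e00 := congrFun (congrFun h1 0) 1
  simp [Matrix.mul_apply, Fin.sum_univ_two] at e01 e10 e00
  have hq : C 0 1 = 0 := by linear_combination (-1 / 2 : ℂ) * e01
  have hr : C 1 0 = 0 := by linear_combination (1 / 2 : ℂ) * e10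
  have hps : C 0 0 = C 1 1 := e00
  have hdet2 : C 0 0 * C 0 0 = 1 := by
    rw [Matrix.det_fin_two, hq, hr, ← hps] at hdetC
    linear_combination hdetC
  have hMC : M = N * C := by
    rw [hC, ← Matrix.mul_assoc, hNadj, Matrix.one_mul]
  rcases mul_self_eq_one_iff.1 hdet2 with hp | hp
  · left
    have hC1 : C = 1 := by
      ext i j
      fin_cases i <;> fin_cases j <;> simp [hq, hr, hp, ← hps]
    apply Subtype.ext
    change M = N
    rw [hMC, hC1, Matrix.mul_one]
  · right
    have hC1 : C = -1 := by
      ext i j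
      fin_cases i <;> fin_cases j <;> simp [hq, hr, hp, ← hps]
    apply Subtype.ext
    change M = ((-B : SL(2, ℂ)) : Matrix (Fin 2) (Fin 2) ℂ)
    rw [Matrix.SpecialLinearGroup.coe_neg, ← hN, hMC, hC1, Matrix.mul_neg, Matrix.mul_one]



/-! ### Surjectivity of `A ↦ Λ(A)` onto `L↑₊` -/

section Surjectivity

/-- The standard basis vectors `e_μ` of space-time (Mathlib's `PiLp.basisFun`). [folklore] -/
private def bv (μ : Fin 4) : Literature.MathematicalPhysics.QuantumLattice.SpaceTime 3 := PiLp.basisFun 2 ℝ (Fin 4) μ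

/-- Unfolding of `bv`. [folklore] -/
private theorem bv_def (μ : Fin 4) : bv μ = PiLp.basisFun 2 ℝ (Fin 4) μ := rfl

/-- Coordinates of the basis vectors: `(e_μ)^ν = δ_{μν}`. [folklore] -/
private theorem bv_apply (μ ν : Fin 4) : bv μ ν = if ν = μ then 1 else 0 := by
  rw [bv_def, PiLp.basisFun_apply, PiLp.single_apply]

/-- `e₀` is the basis vector of index `0`. [folklore] -/
private theorem e₀_eq_bv : Literature.MathematicalPhysics.QuantumLattice.e₀ 3 = bv 0 := by
  ext ν; rw [bv_apply, Literature.MathematicalPhysics.QuantumLattice.e₀_apply]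

/-- `(e_μ)̰ = σ_μ` (Streater–Wightman (1964), §1-3, eq. (1-11)). [cite: StreaterWightman1964] -/
private theorem toHermitian_bv (μ : Fin 4) : toHermitian (bv μ) = pauliMatrix μ := by
  rw [toHermitian_apply]
  simp [bv_def, ite_smul, Finset.sum_ite_eq']

/-- `η(x, e_{i+1}) = -x^{i+1}`. [folklore] -/
private theorem minkowskiForm_bv_succ (x : Literature.MathematicalPhysics.QuantumLattice.SpaceTime 3) (i : Fin 3) :
    Literature.MathematicalPhysics.QuantumLattice.minkowskiForm 3 x (bv i.succ) = -x i.succ := by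
  rw [Literature.MathematicalPhysics.QuantumLattice.minkowskiForm_apply]
  have h0 : ((0 : Fin 4) = i.succ) ↔ False := ⟨fun h => Fin.succ_ne_zero i h.symm, False.elim⟩
  simp only [bv_apply, Fin.succ_inj, mul_ite, mul_one, mul_zero, Finset.sum_ite_eq',
    Finset.mem_univ, if_true, h0, if_false, zero_sub]

/-- `η(e₀, x) = x⁰` for the basis vector. [folklore] -/
private theorem minkowskiForm_bv_zero (x : Literature.MathematicalPhysics.QuantumLattice.SpaceTime 3) : Literature.MathematicalPhysics.QuantumLattice.minkowskiForm 3 (bv 0) x = x 0 := by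
  rw [← e₀_eq_bv, Literature.MathematicalPhysics.QuantumLattice.minkowskiForm_e₀_left]

/-! #### Step 1: the boost `A₁ = (ṽ + 1)/√(2(v⁰ + 1))` with `Λ(A₁) e₀ = v` -/

/-- `i² = -1` in the form used by `linear_combination`. [folklore] -/
private theorem I_sq' : Complex.I ^ 2 = -1 := Complex.I_sq

/-- Cayley–Hamilton for `ṽ + 1` when `η(v, v) = 1`: `(ṽ + 1)² = ṽ² + 2ṽ + 1 = 2(v⁰ + 1) ṽ` since
`ṽ² = (tr ṽ) ṽ − det ṽ = 2v⁰ ṽ − 1`. [folklore] -/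
private theorem toHermitian_add_one_sq {v : Literature.MathematicalPhysics.QuantumLattice.SpaceTime 3} (hv : Literature.MathematicalPhysics.QuantumLattice.minkowskiForm 3 v v = 1) :
    (toHermitian v + 1) * (toHermitian v + 1) = ((2 * (v 0 + 1) : ℝ) : ℂ) • toHermitian v := by
  rw [Literature.MathematicalPhysics.QuantumLattice.minkowskiForm_apply, Fin.sum_univ_three] at hv
  have hvC : (v 0 : ℂ) * v 0 - ((v 1 : ℂ) * v 1 + (v 2 : ℂ) * v 2 + (v 3 : ℂ) * v 3) = 1 := by
    exact_mod_cast hv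
  rw [toHermitian_eq]
  ext i j
  fin_cases i <;> fin_cases j <;>
    simp [Matrix.mul_apply, Fin.sum_univ_two, Matrix.add_apply, Matrix.smul_apply]
  · linear_combination (-1 : ℂ) * hvC + (-(v 2 : ℂ) ^ 2) * I_sq'
  · ring
  · ring
  · linear_combination (-1 : ℂ) * hvC + (-(v 2 : ℂ) ^ 2) * I_sq'

/-- `det (ṽ + 1) = det ṽ + tr ṽ + 1 = 2(v⁰ + 1)` when `η(v, v) = 1`. [folklore] -/
private theorem det_toHermitian_add_one {v : Literature.MathematicalPhysics.QuantumLattice.SpaceTime 3} (hv : Literature.MathematicalPhysics.QuantumLattice.minkowskiForm 3 v v = 1) :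
    (toHermitian v + 1).det = ((2 * (v 0 + 1) : ℝ) : ℂ) := by
  rw [Literature.MathematicalPhysics.QuantumLattice.minkowskiForm_apply, Fin.sum_univ_three] at hv
  have hvC : (v 0 : ℂ) * v 0 - ((v 1 : ℂ) * v 1 + (v 2 : ℂ) * v 2 + (v 3 : ℂ) * v 3) = 1 := by
    exact_mod_cast hv
  rw [toHermitian_eq, Matrix.det_fin_two]
  simp [Matrix.add_apply]
  linear_combination hvC + ((v 2 : ℂ) ^ 2) * I_sq'

/-- The boost matrix `A₁ = (ṽ + 1)/√(2(v⁰ + 1)) = ṽ^{1/2}`, the positive hermitian square root of `ṽ`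
(Streater–Wightman (1964), §1-3; cf. §1-4, the remark that `p̃/m` is positive definite). [cite: StreaterWightman1964] -/
private def boostMat (v : Literature.MathematicalPhysics.QuantumLattice.SpaceTime 3) : Matrix (Fin 2) (Fin 2) ℂ :=
  (((Real.sqrt (2 * (v 0 + 1)))⁻¹ : ℝ) : ℂ) • (toHermitian v + 1)

/-- The boost matrix is hermitian. [folklore] -/
private theorem boostMat_isHermitian (v : Literature.MathematicalPhysics.QuantumLattice.SpaceTime 3) : (boostMat v).IsHermitian := by
  unfold boostMat Matrix.IsHermitian
  rw [conjTranspose_smul, conjTranspose_add, conjTranspose_one, (isHermitian_toHermitian v).eq]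
  simp only [RCLike.star_def, Complex.conj_ofReal]

/-- `A₁² = ṽ` for the boost matrix `A₁ = (ṽ + 1)/√(2(v⁰ + 1))` when `η(v, v) = 1`, `v⁰ > 0` (Cayley–Hamilton). [folklore] -/
private theorem boostMat_mul_self {v : Literature.MathematicalPhysics.QuantumLattice.SpaceTime 3} (hv : Literature.MathematicalPhysics.QuantumLattice.minkowskiForm 3 v v = 1) (h0 : 0 < v 0) :
    boostMat v * boostMat v = toHermitian v := by
  unfold boostMat
  rw [Matrix.smul_mul, Matrix.mul_smul, toHermitian_add_one_sq hv, smul_smul, smul_smul]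
  have h2 : (0 : ℝ) ≤ 2 * (v 0 + 1) := by linarith
  have hne : (2 * (v 0 + 1) : ℝ) ≠ 0 := by linarith
  have h3 : ((Real.sqrt (2 * (v 0 + 1)))⁻¹ * (Real.sqrt (2 * (v 0 + 1)))⁻¹ : ℝ) * (2 * (v 0 + 1))
      = 1 := by
    rw [← mul_inv, Real.mul_self_sqrt h2, inv_mul_cancel₀ hne]
  have h4 : (((Real.sqrt (2 * (v 0 + 1)))⁻¹ : ℝ) : ℂ) * (((Real.sqrt (2 * (v 0 + 1)))⁻¹ : ℝ) : ℂ) *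
      ((2 * (v 0 + 1) : ℝ) : ℂ) = 1 := by
    exact_mod_cast h3
  rw [h4, one_smul]

/-- `det A₁ = 1` for the boost matrix when `η(v, v) = 1`, `v⁰ > 0`. [folklore] -/
private theorem det_boostMat {v : Literature.MathematicalPhysics.QuantumLattice.SpaceTime 3} (hv : Literature.MathematicalPhysics.QuantumLattice.minkowskiForm 3 v v = 1) (h0 : 0 < v 0) :
    (boostMat v).det = 1 := by
  unfold boostMat
  rw [Matrix.det_smul, det_toHermitian_add_one hv, Fintype.card_fin]
  have h2 : (0 : ℝ) ≤ 2 * (v 0 + 1) := by linarith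
  have hne : (2 * (v 0 + 1) : ℝ) ≠ 0 := by linarith
  have : ((Real.sqrt (2 * (v 0 + 1)))⁻¹ : ℝ) ^ 2 * (2 * (v 0 + 1)) = 1 := by
    rw [inv_pow, Real.sq_sqrt h2, inv_mul_cancel₀ hne]
  exact_mod_cast this

/-- The boost `A₁ ∈ SL(2, ℂ)` taking `e₀` to a given unit future timelike vector `v`
(Streater–Wightman (1964), §1-3). [cite: StreaterWightman1964] -/
private def boostSL {v : Literature.MathematicalPhysics.QuantumLattice.SpaceTime 3} (hv : Literature.MathematicalPhysics.QuantumLattice.minkowskiForm 3 v v = 1) (h0 : 0 < v 0) : SL(2, ℂ) :=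
  ⟨boostMat v, det_boostMat hv h0⟩

/-- The boost takes `e₀` to `v`: `Λ(A₁) e₀ = v` (Streater–Wightman (1964), §1-3, the pure Lorentz transformation of eq. (1-9)). [cite: StreaterWightman1964] -/
private theorem spinActFun_boostSL_e₀ {v : Literature.MathematicalPhysics.QuantumLattice.SpaceTime 3} (hv : Literature.MathematicalPhysics.QuantumLattice.minkowskiForm 3 v v = 1)
    (h0 : 0 < v 0) : spinActFun (boostSL hv h0) (Literature.MathematicalPhysics.QuantumLattice.e₀ 3) = v := by
  apply toHermitian_injective
  rw [toHermitian_spinActFun, toHermitian_e₀, Matrix.mul_one]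
  change boostMat v * (boostMat v)ᴴ = toHermitian v
  rw [(boostMat_isHermitian v).eq, boostMat_mul_self hv h0]

/-! #### Step 2: a rotation `A₂ ∈ SU(2)` with `Λ(A₂) e₀ = e₀`, `Λ(A₂) e₃ = n` -/

/-- For a unitary `A` (`A Aᴴ = 1`), `Λ(A) e₀ = e₀` (Streater–Wightman (1964), §1-3: "`SU₂` corresponds
via (1-14) to the rotation group of three-space"). [cite: StreaterWightman1964] -/
private theorem spinActFun_e₀_of_mul_conjTranspose (A : SL(2, ℂ))
    (hA : (A : Matrix (Fin 2) (Fin 2) ℂ) * (A : Matrix (Fin 2) (Fin 2) ℂ)ᴴ = 1) :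
    spinActFun A (Literature.MathematicalPhysics.QuantumLattice.e₀ 3) = Literature.MathematicalPhysics.QuantumLattice.e₀ 3 := by
  apply toHermitian_injective
  rw [toHermitian_spinActFun, toHermitian_e₀, Matrix.mul_one, hA]

/-- The matrix `(n⃗ + e₃)·σ = ṅ + σ₃` for a spatial vector `n` (`n⁰ = 0`). [folklore] -/
private def rotAux (n : Literature.MathematicalPhysics.QuantumLattice.SpaceTime 3) : Matrix (Fin 2) (Fin 2) ℂ := toHermitian n + pauliMatrix 3

/-- Entries of `ṅ + σ₃` for spatial `n`. [folklore] -/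
private theorem rotAux_eq {n : Literature.MathematicalPhysics.QuantumLattice.SpaceTime 3} (hn0 : n 0 = 0) :
    rotAux n = !![(n 3 : ℂ) + 1, (n 1 : ℂ) - I * n 2; (n 1 : ℂ) + I * n 2, -(n 3 : ℂ) - 1] := by
  rw [rotAux, toHermitian_eq, pauliMatrix_three_eq, hn0]
  ext i j
  fin_cases i <;> fin_cases j <;> simp
  ring

/-- `ṅ + σ₃` is hermitian. [folklore] -/
private theorem rotAux_isHermitian (n : Literature.MathematicalPhysics.QuantumLattice.SpaceTime 3) : (rotAux n).IsHermitian :=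
  (isHermitian_toHermitian n).add (isHermitian_pauliMatrix 3)

/-- `((n⃗ + e₃)·σ)² = |n⃗ + e₃|² = 2(1 + n³)` for a unit spatial vector `n`. [folklore] -/
private theorem rotAux_mul_self {n : Literature.MathematicalPhysics.QuantumLattice.SpaceTime 3} (hn0 : n 0 = 0)
    (hnn : n 1 ^ 2 + n 2 ^ 2 + n 3 ^ 2 = 1) :
    rotAux n * rotAux n = ((2 * (1 + n 3) : ℝ) : ℂ) • (1 : Matrix (Fin 2) (Fin 2) ℂ) := by
  have hC : (n 1 : ℂ) ^ 2 + (n 2 : ℂ) ^ 2 + (n 3 : ℂ) ^ 2 = 1 := by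
    have := congrArg (fun r : ℝ => (r : ℂ)) hnn
    push_cast at this
    exact this
  rw [rotAux_eq hn0]
  ext i j
  fin_cases i <;> fin_cases j <;>
    simp [Matrix.mul_apply, Fin.sum_univ_two, Matrix.smul_apply]
  · linear_combination hC + (-(n 2 : ℂ) ^ 2) * I_sq'
  · ring
  · ring
  · linear_combination hC + (-(n 2 : ℂ) ^ 2) * I_sq'

/-- `(m·σ) σ₃ (m·σ) = 2 m³ (m·σ) − |m|² σ₃ = 2(1 + n³) ṅ` for `m = n⃗ + e₃`, `|n⃗| = 1`. [folklore] -/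
private theorem rotAux_mul_pauli_mul {n : Literature.MathematicalPhysics.QuantumLattice.SpaceTime 3} (hn0 : n 0 = 0)
    (hnn : n 1 ^ 2 + n 2 ^ 2 + n 3 ^ 2 = 1) :
    rotAux n * pauliMatrix 3 * rotAux n = ((2 * (1 + n 3) : ℝ) : ℂ) • toHermitian n := by
  have hC : (n 1 : ℂ) ^ 2 + (n 2 : ℂ) ^ 2 + (n 3 : ℂ) ^ 2 = 1 := by
    have := congrArg (fun r : ℝ => (r : ℂ)) hnn
    push_cast at this
    exact this
  rw [rotAux_eq hn0, toHermitian_eq, pauliMatrix_three_eq, hn0]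
  ext i j
  fin_cases i <;> fin_cases j <;>
    simp [Matrix.mul_apply, Fin.sum_univ_two, Matrix.smul_apply]
  · linear_combination (-1 : ℂ) * hC + ((n 2 : ℂ) ^ 2) * I_sq'
  · ring
  · ring
  · linear_combination hC + (-(n 2 : ℂ) ^ 2) * I_sq'

/-- `det ((n⃗ + e₃)·σ) = −2(1 + n³)` for a unit spatial vector `n`. [folklore] -/
private theorem det_rotAux {n : Literature.MathematicalPhysics.QuantumLattice.SpaceTime 3} (hn0 : n 0 = 0)
    (hnn : n 1 ^ 2 + n 2 ^ 2 + n 3 ^ 2 = 1) :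
    (rotAux n).det = -((2 * (1 + n 3) : ℝ) : ℂ) := by
  have hC : (n 1 : ℂ) ^ 2 + (n 2 : ℂ) ^ 2 + (n 3 : ℂ) ^ 2 = 1 := by
    have := congrArg (fun r : ℝ => (r : ℂ)) hnn
    push_cast at this
    exact this
  rw [rotAux_eq hn0, Matrix.det_fin_two]
  simp
  linear_combination (-1 : ℂ) * hC + ((n 2 : ℂ) ^ 2) * I_sq'

/-- The rotation matrix `A₂ = i (n⃗ + e₃)·σ / √(2(1 + n³)) ∈ SU(2)` (rotation by `π` about the
bisector of `e₃` and `n⃗`, which takes `e₃` to `n⃗`). [folklore] -/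
private def rotMat (n : Literature.MathematicalPhysics.QuantumLattice.SpaceTime 3) : Matrix (Fin 2) (Fin 2) ℂ :=
  (I * (((Real.sqrt (2 * (1 + n 3)))⁻¹ : ℝ) : ℂ)) • rotAux n

/-- The rotation matrix is unitary: `A₂ A₂ᴴ = 1`. [folklore] -/
private theorem rotMat_mul_conjTranspose {n : Literature.MathematicalPhysics.QuantumLattice.SpaceTime 3} (hn0 : n 0 = 0)
    (hnn : n 1 ^ 2 + n 2 ^ 2 + n 3 ^ 2 = 1) (h3 : 0 < 1 + n 3) :
    rotMat n * (rotMat n)ᴴ = 1 := by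
  unfold rotMat
  rw [conjTranspose_smul, (rotAux_isHermitian n).eq, Matrix.smul_mul, Matrix.mul_smul,
    rotAux_mul_self hn0 hnn, smul_smul, smul_smul]
  have h2 : (0 : ℝ) ≤ 2 * (1 + n 3) := by linarith
  have hne : (2 * (1 + n 3) : ℝ) ≠ 0 := by linarith
  have h4 : ((Real.sqrt (2 * (1 + n 3)))⁻¹ * (Real.sqrt (2 * (1 + n 3)))⁻¹ : ℝ) * (2 * (1 + n 3))
      = 1 := by
    rw [← mul_inv, Real.mul_self_sqrt h2, inv_mul_cancel₀ hne]
  have h4C := congrArg (fun r : ℝ => (r : ℂ)) h4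
  push_cast at h4C
  have h5 : I * (((Real.sqrt (2 * (1 + n 3)))⁻¹ : ℝ) : ℂ) *
      star (I * (((Real.sqrt (2 * (1 + n 3)))⁻¹ : ℝ) : ℂ)) * ((2 * (1 + n 3) : ℝ) : ℂ) = 1 := by
    rw [star_mul', Complex.star_def, Complex.conj_I, Complex.conj_ofReal]
    push_cast
    linear_combination (-(((Real.sqrt (2 * (1 + n 3)) : ℂ))⁻¹ *
      ((Real.sqrt (2 * (1 + n 3)) : ℂ))⁻¹ * (2 * (1 + (n 3 : ℂ))))) * I_sq' + h4C
  rw [h5, one_smul]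

/-- The rotation matrix takes `σ₃` to `ṅ`: `A₂ σ₃ A₂ᴴ = ṅ`. [folklore] -/
private theorem rotMat_mul_pauli_mul_conjTranspose {n : Literature.MathematicalPhysics.QuantumLattice.SpaceTime 3} (hn0 : n 0 = 0)
    (hnn : n 1 ^ 2 + n 2 ^ 2 + n 3 ^ 2 = 1) (h3 : 0 < 1 + n 3) :
    rotMat n * pauliMatrix 3 * (rotMat n)ᴴ = toHermitian n := by
  unfold rotMat
  rw [conjTranspose_smul, (rotAux_isHermitian n).eq, Matrix.smul_mul, Matrix.smul_mul,
    Matrix.mul_smul, rotAux_mul_pauli_mul hn0 hnn, smul_smul, smul_smul]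
  have h2 : (0 : ℝ) ≤ 2 * (1 + n 3) := by linarith
  have hne : (2 * (1 + n 3) : ℝ) ≠ 0 := by linarith
  have h4 : ((Real.sqrt (2 * (1 + n 3)))⁻¹ * (Real.sqrt (2 * (1 + n 3)))⁻¹ : ℝ) * (2 * (1 + n 3))
      = 1 := by
    rw [← mul_inv, Real.mul_self_sqrt h2, inv_mul_cancel₀ hne]
  have h4C := congrArg (fun r : ℝ => (r : ℂ)) h4
  push_cast at h4C
  have h5 : I * (((Real.sqrt (2 * (1 + n 3)))⁻¹ : ℝ) : ℂ) *
      star (I * (((Real.sqrt (2 * (1 + n 3)))⁻¹ : ℝ) : ℂ)) * ((2 * (1 + n 3) : ℝ) : ℂ) = 1 := by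
    rw [star_mul', Complex.star_def, Complex.conj_I, Complex.conj_ofReal]
    push_cast
    linear_combination (-(((Real.sqrt (2 * (1 + n 3)) : ℂ))⁻¹ *
      ((Real.sqrt (2 * (1 + n 3)) : ℂ))⁻¹ * (2 * (1 + (n 3 : ℂ))))) * I_sq' + h4C
  rw [h5, one_smul]

/-- `det A₂ = 1` for the rotation matrix. [folklore] -/
private theorem det_rotMat {n : Literature.MathematicalPhysics.QuantumLattice.SpaceTime 3} (hn0 : n 0 = 0)
    (hnn : n 1 ^ 2 + n 2 ^ 2 + n 3 ^ 2 = 1) (h3 : 0 < 1 + n 3) : (rotMat n).det = 1 := by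
  unfold rotMat
  rw [Matrix.det_smul, det_rotAux hn0 hnn, Fintype.card_fin]
  have h2 : (0 : ℝ) ≤ 2 * (1 + n 3) := by linarith
  have hne : (2 * (1 + n 3) : ℝ) ≠ 0 := by linarith
  have h4 : ((Real.sqrt (2 * (1 + n 3)))⁻¹ : ℝ) ^ 2 * (2 * (1 + n 3)) = 1 := by
    rw [inv_pow, Real.sq_sqrt h2, inv_mul_cancel₀ hne]
  have h4C := congrArg (fun r : ℝ => (r : ℂ)) h4
  push_cast at h4C
  push_cast
  linear_combination (-(((Real.sqrt (2 * (1 + n 3)) : ℂ))⁻¹ ^ 2 * (2 * (1 + (n 3 : ℂ))))) * I_sq' +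
    h4C

/-- A rotation in `SL(2, ℂ)` fixing `e₀` and taking `e₃` to a given unit spatial vector `n`: for
`n ≠ −e₃` the matrix `rotMat n`, for `n = −e₃` the matrix `i σ₁` (Streater–Wightman (1964), §1-3,
the rotations of eq. (1-9)). [cite: StreaterWightman1964] -/
private theorem exists_SL_e₃ {n : Literature.MathematicalPhysics.QuantumLattice.SpaceTime 3} (hn0 : n 0 = 0)
    (hnn : n 1 ^ 2 + n 2 ^ 2 + n 3 ^ 2 = 1) :
    ∃ A : SL(2, ℂ), spinActFun A (Literature.MathematicalPhysics.QuantumLattice.e₀ 3) = Literature.MathematicalPhysics.QuantumLattice.e₀ 3 ∧ spinActFun A (bv 3) = n := by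
  by_cases h3 : n 3 = -1
  · -- `n = -e₃`: take `A = i σ₁`
    have h12 : n 1 ^ 2 + n 2 ^ 2 = 0 := by rw [h3] at hnn; linarith
    have h1 : n 1 = 0 := by nlinarith [sq_nonneg (n 1), sq_nonneg (n 2)]
    have h2 : n 2 = 0 := by nlinarith [sq_nonneg (n 1), sq_nonneg (n 2)]
    have hdet : (I • pauliMatrix 1).det = 1 := by
      rw [pauliMatrix_one_eq, Matrix.det_fin_two]
      simp
    refine ⟨⟨I • pauliMatrix 1, hdet⟩, ?_, ?_⟩
    · apply spinActFun_e₀_of_mul_conjTranspose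
      change (I • pauliMatrix 1) * (I • pauliMatrix 1)ᴴ = 1
      rw [pauliMatrix_one_eq]
      ext i j
      fin_cases i <;> fin_cases j <;> simp [Matrix.mul_apply, Fin.sum_univ_two, conjTranspose_apply]
    · apply toHermitian_injective
      rw [toHermitian_spinActFun, toHermitian_bv, toHermitian_eq, hn0, h1, h2, h3]
      change (I • pauliMatrix 1) * pauliMatrix 3 * (I • pauliMatrix 1)ᴴ = _
      rw [pauliMatrix_one_eq, pauliMatrix_three_eq]
      ext i j
      fin_cases i <;> fin_cases j <;> simp [Matrix.mul_apply, Fin.sum_univ_two, conjTranspose_apply]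
  · have h3' : 0 < 1 + n 3 := by
      have : -1 ≤ n 3 := by nlinarith [sq_nonneg (n 1), sq_nonneg (n 2), sq_nonneg (n 3 + 1)]
      rcases this.lt_or_eq with h | h
      · linarith
      · exact absurd h.symm h3
    refine ⟨⟨rotMat n, det_rotMat hn0 hnn h3'⟩, ?_, ?_⟩
    · exact spinActFun_e₀_of_mul_conjTranspose _ (rotMat_mul_conjTranspose hn0 hnn h3')
    · apply toHermitian_injective
      rw [toHermitian_spinActFun, toHermitian_bv]
      exact rotMat_mul_pauli_mul_conjTranspose hn0 hnn h3'

/-! #### Step 3: a restricted Lorentz transformation fixing `e₀` and `e₃` is `Λ(diag(α, ᾱ))` -/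

/-- `η(x, x) = (x⁰)² − (x¹)² − (x²)² − (x³)²` (Streater–Wightman (1964), §1-1, eq. (1-1)). [cite: StreaterWightman1964] -/
private theorem minkowskiForm_self_eq (x : Literature.MathematicalPhysics.QuantumLattice.SpaceTime 3) :
    Literature.MathematicalPhysics.QuantumLattice.minkowskiForm 3 x x = x 0 ^ 2 - (x 1 ^ 2 + x 2 ^ 2 + x 3 ^ 2) := by
  rw [Literature.MathematicalPhysics.QuantumLattice.minkowskiForm_apply, Fin.sum_univ_three]
  simp only [sq]
  rfl

/-- `η(e_{i+1}, e_{i+1}) = −1`. [folklore] -/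
private theorem minkowskiForm_bv_succ_self (i : Fin 3) :
    Literature.MathematicalPhysics.QuantumLattice.minkowskiForm 3 (bv i.succ) (bv i.succ) = -1 := by
  rw [minkowskiForm_bv_succ, bv_apply, if_pos rfl]

/-- A restricted Lorentz transformation fixing `e₀` and `e₃` is a rotation in the `(1, 2)`-plane,
hence of the form `Λ(diag(α, ᾱ))` with `α² = u¹ − i u²`, `u = Λ e₁` (Streater–Wightman (1964),
§1-3, the rotations of eq. (1-9); the determinant condition excludes the reflection). [cite: StreaterWightman1964] -/
private theorem exists_SL_of_fix {Λ : Literature.MathematicalPhysics.QuantumLattice.SpaceTime 3 ≃L[ℝ] Literature.MathematicalPhysics.QuantumLattice.SpaceTime 3}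
    (hΛ : Λ ∈ Literature.MathematicalPhysics.QuantumLattice.restrictedLorentzGroup 3) (h0 : Λ (bv 0) = bv 0) (h3 : Λ (bv 3) = bv 3) :
    ∃ A : SL(2, ℂ), spinActFun A = ⇑Λ := by
  obtain ⟨hL, -, hP⟩ := (Literature.MathematicalPhysics.QuantumLattice.mem_restrictedLorentzGroup_iff Λ).1 hΛ
  set u := Λ (bv 1) with hu
  set w := Λ (bv 2) with hw
  have e3 : (3 : Fin 4) = (2 : Fin 3).succ := rfl
  have e1 : (1 : Fin 4) = (0 : Fin 3).succ := rfl
  have e2 : (2 : Fin 4) = (1 : Fin 3).succ := rfl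
  -- vanishing coordinates
  have hu0 : u 0 = 0 := by
    have := hL (bv 0) (bv 1)
    rw [h0, minkowskiForm_bv_zero, minkowskiForm_bv_zero, bv_apply] at this
    simpa using this
  have hw0 : w 0 = 0 := by
    have := hL (bv 0) (bv 2)
    rw [h0, minkowskiForm_bv_zero, minkowskiForm_bv_zero, bv_apply] at this
    simpa using this
  have hu3 : u 3 = 0 := by
    have := hL (bv 1) (bv 3)
    rw [h3, e3, minkowskiForm_bv_succ, minkowskiForm_bv_succ, bv_apply] at this
    simpa using this
  have hw3 : w 3 = 0 := by
    have := hL (bv 2) (bv 3)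
    rw [h3, e3, minkowskiForm_bv_succ, minkowskiForm_bv_succ, bv_apply] at this
    simpa using this
  -- orthonormality
  have huu : u 1 ^ 2 + u 2 ^ 2 = 1 := by
    have := hL (bv 1) (bv 1)
    rw [e1, minkowskiForm_bv_succ_self, ← e1, minkowskiForm_self_eq, hu0, hu3] at this
    linarith
  have hww : w 1 ^ 2 + w 2 ^ 2 = 1 := by
    have := hL (bv 2) (bv 2)
    rw [e2, minkowskiForm_bv_succ_self, ← e2, minkowskiForm_self_eq, hw0, hw3] at this
    linarith
  have huw : u 1 * w 1 + u 2 * w 2 = 0 := by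
    have := hL (bv 1) (bv 2)
    rw [e2, minkowskiForm_bv_succ, ← e2, Literature.MathematicalPhysics.QuantumLattice.minkowskiForm_apply, Fin.sum_univ_three, hu0, bv_apply]
      at this
    simp at this
    rw [hu3] at this
    linarith
  -- the determinant
  have hdet : u 1 * w 2 - u 2 * w 1 = 1 := by
    set b : Module.Basis (Fin 4) ℝ (Literature.MathematicalPhysics.QuantumLattice.SpaceTime 3) := PiLp.basisFun 2 ℝ (Fin 4) with hb
    have hM : LinearMap.toMatrix b b
        ((Λ : Literature.MathematicalPhysics.QuantumLattice.SpaceTime 3 →L[ℝ] Literature.MathematicalPhysics.QuantumLattice.SpaceTime 3) : Literature.MathematicalPhysics.QuantumLattice.SpaceTime 3 →ₗ[ℝ] Literature.MathematicalPhysics.QuantumLattice.SpaceTime 3) =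
        !![1, 0, 0, 0; 0, u 1, w 1, 0; 0, u 2, w 2, 0; 0, 0, 0, 1] := by
      ext k i
      rw [LinearMap.toMatrix_apply, hb, PiLp.basisFun_repr]
      change (Λ (bv i)) k = _
      fin_cases i
      · fin_cases k <;> simp [h0, bv_apply]
      · fin_cases k <;> simp [← hu, hu0, hu3]
      · fin_cases k <;> simp [← hw, hw0, hw3]
      · fin_cases k <;> simp [h3, bv_apply]
    have hd := hP
    unfold Literature.MathematicalPhysics.QuantumLattice.IsProper at hd
    rw [← LinearMap.det_toMatrix b, hM, Matrix.det_succ_row_zero, Fin.sum_univ_four] at hd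
    simp [Matrix.det_fin_three, Fin.succAbove] at hd
    linear_combination hd
  have hw1 : w 1 = -u 2 := by linear_combination (u 1) * huw - (u 2) * hdet - (w 1) * huu
  have hw2 : w 2 = u 1 := by linear_combination (u 2) * huw + (u 1) * hdet - (w 2) * huu
  -- the phase `α`, `α² = u¹ − i u²`, `|α| = 1`
  obtain ⟨α, hα⟩ := IsAlgClosed.exists_pow_nat_eq ((u 1 : ℂ) - I * u 2) (n := 2) two_pos
  have hnorm : Complex.normSq α = 1 := by
    have h1 : Complex.normSq α ^ 2 = 1 := by
      rw [← map_pow, hα, Complex.normSq_apply]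
      simp
      nlinarith [huu]
    exact (pow_eq_one_iff_of_nonneg (Complex.normSq_nonneg α) two_ne_zero).1 h1
  have hαα : α * conj α = 1 := by rw [Complex.mul_conj, hnorm]; simp
  have hαα' : conj α * α = 1 := by rw [mul_comm, hαα]
  have hα2 : α * α = (u 1 : ℂ) - I * u 2 := by rw [← sq, hα]
  have hα2' : conj α * conj α = (u 1 : ℂ) + I * u 2 := by
    rw [← map_mul, hα2, map_sub, map_mul, Complex.conj_ofReal, Complex.conj_ofReal, Complex.conj_I]
    ring
  have hdetA : (!![α, 0; 0, conj α] : Matrix (Fin 2) (Fin 2) ℂ).det = 1 := by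
    rw [Matrix.det_fin_two]; simp [hαα]
  refine ⟨⟨!![α, 0; 0, conj α], hdetA⟩, ?_⟩
  -- `Λ(A₃)` and `Λ` agree on the basis
  have hct : (!![α, 0; 0, conj α] : Matrix (Fin 2) (Fin 2) ℂ)ᴴ = !![conj α, 0; 0, α] := by
    ext i j
    fin_cases i <;> fin_cases j <;> simp [conjTranspose_apply]
  have c0 : !![α, 0; 0, conj α] * pauliMatrix 0 * !![conj α, 0; 0, α] = toHermitian (Λ (bv 0)) := by
    rw [pauliMatrix_zero, Matrix.mul_one, h0, toHermitian_bv, pauliMatrix_zero]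
    ext i j
    fin_cases i <;> fin_cases j <;> simp [Matrix.mul_apply, Fin.sum_univ_two, hαα, hαα']
  have c1 : !![α, 0; 0, conj α] * pauliMatrix 1 * !![conj α, 0; 0, α] = toHermitian (Λ (bv 1)) := by
    rw [pauliMatrix_one_eq, ← hu, toHermitian_eq, hu0, hu3]
    ext i j
    fin_cases i <;> fin_cases j <;> simp [Matrix.mul_apply, Fin.sum_univ_two, hα2, hα2']
  have c2 : !![α, 0; 0, conj α] * pauliMatrix 2 * !![conj α, 0; 0, α] = toHermitian (Λ (bv 2)) := by
    rw [pauliMatrix_two_eq, ← hw, toHermitian_eq, hw0, hw3, hw1, hw2]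
    ext i j
    fin_cases i <;> fin_cases j <;> simp [Matrix.mul_apply, Fin.sum_univ_two]
    · rw [show -(α * I * α) = -I * (α * α) by ring, hα2]
      push_cast
      linear_combination ((u 2 : ℂ)) * I_sq'
    · rw [show (starRingEnd ℂ) α * I * (starRingEnd ℂ) α = I * (conj α * conj α) by ring, hα2']
      push_cast
      linear_combination ((u 2 : ℂ)) * I_sq'
  have c3 : !![α, 0; 0, conj α] * pauliMatrix 3 * !![conj α, 0; 0, α] = toHermitian (Λ (bv 3)) := by
    rw [pauliMatrix_three_eq, h3, toHermitian_bv, pauliMatrix_three_eq]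
    ext i j
    fin_cases i <;> fin_cases j <;> simp [Matrix.mul_apply, Fin.sum_univ_two, hαα, hαα']
  have hbasis : ∀ μ : Fin 4, spinActFun ⟨!![α, 0; 0, conj α], hdetA⟩ (bv μ) = Λ (bv μ) := by
    intro μ
    apply toHermitian_injective
    rw [toHermitian_spinActFun, toHermitian_bv]
    change !![α, 0; 0, conj α] * pauliMatrix μ * !![α, 0; 0, conj α]ᴴ = _
    rw [hct]
    fin_cases μ
    exacts [c0, c1, c2, c3]
  have hlin : spinActLin ⟨!![α, 0; 0, conj α], hdetA⟩ =
      ((Λ : Literature.MathematicalPhysics.QuantumLattice.SpaceTime 3 →L[ℝ] Literature.MathematicalPhysics.QuantumLattice.SpaceTime 3) : Literature.MathematicalPhysics.QuantumLattice.SpaceTime 3 →ₗ[ℝ] Literature.MathematicalPhysics.QuantumLattice.SpaceTime 3) :=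
    (PiLp.basisFun 2 ℝ (Fin 4)).ext fun μ => hbasis μ
  funext x
  exact LinearMap.congr_fun hlin x

/-! #### Step 4: assembling the decomposition `Λ = Λ(A₁) Λ(A₂) Λ(A₃)` -/

/-- Discharge of the named fact `spinActFun_surjective`: every restricted Lorentz transformation
is `Λ(A)` for some `A ∈ SL(2, ℂ)` (Streater–Wightman (1964), §1-3, after eq. (1-15): "`A → Λ(A)`
is a homomorphism of `SL(2, ℂ)` onto `L↑₊`"), via `Λ = Λ(A₁) Λ(A₂) Λ(A₃)` (boost, rotation
`e₃ ↦ n`, rotation about `e₃`; cf. the decomposition (1-9)). [cite: StreaterWightman1964] -/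
theorem spinActFun_surjective_holds : spinActFun_surjective := by
  intro Λ hΛ
  obtain ⟨hL, hO, -⟩ := (Literature.MathematicalPhysics.QuantumLattice.mem_restrictedLorentzGroup_iff Λ).1 hΛ
  -- Step 1: boost `e₀` to `v = Λ e₀`
  have hv : Literature.MathematicalPhysics.QuantumLattice.minkowskiForm 3 (Λ (Literature.MathematicalPhysics.QuantumLattice.e₀ 3)) (Λ (Literature.MathematicalPhysics.QuantumLattice.e₀ 3)) = 1 := by rw [hL]; exact Literature.MathematicalPhysics.QuantumLattice.minkowskiForm_e₀_e₀
  have hv0 : 0 < Λ (Literature.MathematicalPhysics.QuantumLattice.e₀ 3) 0 := hO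
  set A₁ := boostSL hv hv0 with hA₁
  set Λ₁ : Literature.MathematicalPhysics.QuantumLattice.SpaceTime 3 ≃L[ℝ] Literature.MathematicalPhysics.QuantumLattice.SpaceTime 3 := (spinLorentz A₁)⁻¹ * Λ with hΛ₁def
  have hΛ₁ : Λ₁ ∈ Literature.MathematicalPhysics.QuantumLattice.restrictedLorentzGroup 3 :=
    Subgroup.mul_mem _ (Subgroup.inv_mem _ (spinLorentz_mem_restrictedLorentzGroup A₁)) hΛ
  have hL₁ : Λ₁ ∈ Literature.MathematicalPhysics.QuantumLattice.lorentzGroup 3 := Literature.MathematicalPhysics.QuantumLattice.restrictedLorentzGroup_le_lorentzGroup hΛ₁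
  have hΛ₁e₀ : Λ₁ (bv 0) = bv 0 := by
    rw [← e₀_eq_bv]
    change (spinLorentz A₁)⁻¹ (Λ (Literature.MathematicalPhysics.QuantumLattice.e₀ 3)) = Literature.MathematicalPhysics.QuantumLattice.e₀ 3
    conv_lhs => rw [← spinActFun_boostSL_e₀ hv hv0]
    exact Literature.MathematicalPhysics.QuantumLattice.continuousLinearEquiv_inv_apply_apply (spinLorentz A₁) (Literature.MathematicalPhysics.QuantumLattice.e₀ 3)
  -- Step 2: rotate `e₃` to `n = Λ₁ e₃`
  have hn0 : Λ₁ (bv 3) 0 = 0 := by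
    have := hL₁ (bv 0) (bv 3)
    rw [hΛ₁e₀, minkowskiForm_bv_zero, minkowskiForm_bv_zero, bv_apply] at this
    simpa using this
  have hnn : Λ₁ (bv 3) 1 ^ 2 + Λ₁ (bv 3) 2 ^ 2 + Λ₁ (bv 3) 3 ^ 2 = 1 := by
    have := hL₁ (bv 3) (bv 3)
    rw [show (3 : Fin 4) = (2 : Fin 3).succ from rfl, minkowskiForm_bv_succ_self,
      show (2 : Fin 3).succ = (3 : Fin 4) from rfl, minkowskiForm_self_eq, hn0] at this
    linarith
  obtain ⟨A₂, hA₂0, hA₂3⟩ := exists_SL_e₃ hn0 hnn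
  set Λ₂ : Literature.MathematicalPhysics.QuantumLattice.SpaceTime 3 ≃L[ℝ] Literature.MathematicalPhysics.QuantumLattice.SpaceTime 3 := (spinLorentz A₂)⁻¹ * Λ₁ with hΛ₂def
  have hΛ₂ : Λ₂ ∈ Literature.MathematicalPhysics.QuantumLattice.restrictedLorentzGroup 3 :=
    Subgroup.mul_mem _ (Subgroup.inv_mem _ (spinLorentz_mem_restrictedLorentzGroup A₂)) hΛ₁
  have hΛ₂e₀ : Λ₂ (bv 0) = bv 0 := by
    change (spinLorentz A₂)⁻¹ (Λ₁ (bv 0)) = bv 0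
    rw [hΛ₁e₀]
    conv_lhs => rw [← e₀_eq_bv, ← hA₂0]
    rw [← e₀_eq_bv]
    exact Literature.MathematicalPhysics.QuantumLattice.continuousLinearEquiv_inv_apply_apply (spinLorentz A₂) (Literature.MathematicalPhysics.QuantumLattice.e₀ 3)
  have hΛ₂e₃ : Λ₂ (bv 3) = bv 3 := by
    change (spinLorentz A₂)⁻¹ (Λ₁ (bv 3)) = bv 3
    conv_lhs => rw [← hA₂3]
    exact Literature.MathematicalPhysics.QuantumLattice.continuousLinearEquiv_inv_apply_apply (spinLorentz A₂) (bv 3)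
  -- Step 3
  obtain ⟨A₃, hA₃⟩ := exists_SL_of_fix hΛ₂ hΛ₂e₀ hΛ₂e₃
  -- Step 4
  refine ⟨A₁ * A₂ * A₃, ?_⟩
  rw [spinActFun_mul_holds, spinActFun_mul_holds, hA₃]
  funext x
  simp only [Function.comp_apply]
  change Λ x = spinLorentz A₁ (spinLorentz A₂ (((spinLorentz A₂)⁻¹ * ((spinLorentz A₁)⁻¹ * Λ)) x))
  simp only [Literature.MathematicalPhysics.QuantumLattice.continuousLinearEquiv_mul_apply, Literature.MathematicalPhysics.QuantumLattice.continuousLinearEquiv_apply_inv_apply]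

/-- Discharge of the named fact `exists_spinActFun_eq_of_mem_restrictedLorentzGroup` (the
Mathlib-style restatement of `spinActFun_surjective`; Streater–Wightman (1964), §1-3). [cite: StreaterWightman1964] -/
theorem exists_spinActFun_eq_of_mem_restrictedLorentzGroup_holds :
    exists_spinActFun_eq_of_mem_restrictedLorentzGroup := by
  intro Λ hΛ
  obtain ⟨A, hA⟩ := spinActFun_surjective_holds Λ hΛ
  exact ⟨A, hA.symm⟩

end Surjectivity

/-! ### The covering homomorphism `SL(2, ℂ) → L↑₊` and its properness -/

/-- The covering homomorphism `π : SL(2, ℂ) →* L↑₊`, `A ↦ Λ(A)` (Streater–Wightman (1964), §1-3,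
eq. (1-15)). [cite: StreaterWightman1964] -/
def spinCoverHom : SL(2, ℂ) →* Literature.MathematicalPhysics.QuantumLattice.restrictedLorentzGroup 3 where
  toFun A := ⟨spinLorentz A, spinLorentz_mem_restrictedLorentzGroup A⟩
  map_one' := Subtype.ext spinLorentz_one
  map_mul' A B := Subtype.ext (spinLorentz_mul A B)

/-- `⇑(spinCoverHom A) = spinActFun A` (unfolding). [folklore] -/
theorem coe_spinCoverHom (A : SL(2, ℂ)) :
    ((spinCoverHom A : Literature.MathematicalPhysics.QuantumLattice.SpaceTime 3 ≃L[ℝ] Literature.MathematicalPhysics.QuantumLattice.SpaceTime 3) : Literature.MathematicalPhysics.QuantumLattice.SpaceTime 3 → Literature.MathematicalPhysics.QuantumLattice.SpaceTime 3) = spinActFun A :=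
  coe_spinLorentz A

/-- `A ↦ Λ(A) x` is continuous (the coordinates are polynomials in the entries of `A`, `Ā`;
Streater–Wightman (1964), §1-3: "the corresponding `Λ(A)` varies continuously"). [cite: StreaterWightman1964] -/
theorem continuous_spinActFun_apply (x : Literature.MathematicalPhysics.QuantumLattice.SpaceTime 3) :
    Continuous fun A : SL(2, ℂ) => spinActFun A x := by
  have : (fun A : SL(2, ℂ) => spinActFun A x) = fun A : SL(2, ℂ) => WithLp.toLp 2 (fun μ =>
      2⁻¹ * ((pauliMatrix μ * ((A : Matrix (Fin 2) (Fin 2) ℂ) * toHermitian x *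
        (A : Matrix (Fin 2) (Fin 2) ℂ)ᴴ)).trace).re) := rfl
  rw [this]
  refine (PiLp.continuous_toLp 2 _).comp (continuous_pi fun μ => ?_)
  refine continuous_const.mul (Complex.continuous_re.comp ?_)
  refine Continuous.matrix_trace (continuous_const.matrix_mul ?_)
  exact (continuous_subtype_val.matrix_mul continuous_const).matrix_mul
    continuous_subtype_val.matrix_conjTranspose

/-- The covering homomorphism is continuous (Streater–Wightman (1964), §1-3). [cite: StreaterWightman1964] -/
theorem continuous_spinCoverHom : Continuous spinCoverHom := by
  apply continuous_induced_rng.2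
  change Continuous fun A : SL(2, ℂ) =>
    ((spinLorentz A : Literature.MathematicalPhysics.QuantumLattice.SpaceTime 3 ≃L[ℝ] Literature.MathematicalPhysics.QuantumLattice.SpaceTime 3) : Literature.MathematicalPhysics.QuantumLattice.SpaceTime 3 →L[ℝ] Literature.MathematicalPhysics.QuantumLattice.SpaceTime 3)
  rw [continuous_clm_apply]
  intro y
  simp only [ContinuousLinearEquiv.coe_coe, coe_spinLorentz]
  exact continuous_spinActFun_apply y

/-- `Λ ↦ (Λ e₀)⁰` is continuous on `L↑₊`. [folklore] -/
theorem _root_.Literature.MathematicalPhysics.QuantumLattice.restrictedLorentzGroup.continuous_apply_e₀_zero :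
    Continuous fun Λ : Literature.MathematicalPhysics.QuantumLattice.restrictedLorentzGroup 3 =>
      (Λ : Literature.MathematicalPhysics.QuantumLattice.SpaceTime 3 ≃L[ℝ] Literature.MathematicalPhysics.QuantumLattice.SpaceTime 3) (Literature.MathematicalPhysics.QuantumLattice.e₀ 3) 0 := by
  have h1 := Literature.MathematicalPhysics.QuantumLattice.restrictedLorentzGroup.continuous_coe (d := 3)
  have h2 : Continuous fun Λ : Literature.MathematicalPhysics.QuantumLattice.restrictedLorentzGroup 3 =>
      ((Λ : Literature.MathematicalPhysics.QuantumLattice.SpaceTime 3 ≃L[ℝ] Literature.MathematicalPhysics.QuantumLattice.SpaceTime 3) : Literature.MathematicalPhysics.QuantumLattice.SpaceTime 3 →L[ℝ] Literature.MathematicalPhysics.QuantumLattice.SpaceTime 3) (Literature.MathematicalPhysics.QuantumLattice.e₀ 3) :=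
    (ContinuousLinearMap.apply ℝ (Literature.MathematicalPhysics.QuantumLattice.SpaceTime 3) (Literature.MathematicalPhysics.QuantumLattice.e₀ 3)).continuous.comp h1
  exact (EuclideanSpace.proj (0 : Fin 4)).continuous.comp h2

/-- `L↑₊` is Hausdorff in the operator-norm topology (it embeds into the Hausdorff space of continuous linear maps). [folklore] -/
instance _root_.Literature.MathematicalPhysics.QuantumLattice.restrictedLorentzGroup.instT2Space {d : ℕ} : T2Space (Literature.MathematicalPhysics.QuantumLattice.restrictedLorentzGroup d) :=
  T2Space.of_injective_continuous
    (f := fun Λ : Literature.MathematicalPhysics.QuantumLattice.restrictedLorentzGroup d =>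
      ((Λ : Literature.MathematicalPhysics.QuantumLattice.SpaceTime d ≃L[ℝ] Literature.MathematicalPhysics.QuantumLattice.SpaceTime d) : Literature.MathematicalPhysics.QuantumLattice.SpaceTime d →L[ℝ] Literature.MathematicalPhysics.QuantumLattice.SpaceTime d))
    (fun _ _ h => Subtype.ext (ContinuousLinearEquiv.coe_injective h))
    Literature.MathematicalPhysics.QuantumLattice.restrictedLorentzGroup.continuous_coe

/-- The set of `A ∈ SL(2, ℂ)` with all entries of norm `≤ R` is compact (Heine–Borel). [folklore] -/
theorem isCompact_entry_le (R : ℝ) :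
    IsCompact {A : SL(2, ℂ) | ∀ i j, ‖(A : Matrix (Fin 2) (Fin 2) ℂ) i j‖ ≤ R} := by
  have hK : IsCompact {M : Matrix (Fin 2) (Fin 2) ℂ | ∀ i j, ‖M i j‖ ≤ R} := by
    have : {M : Matrix (Fin 2) (Fin 2) ℂ | ∀ i j, ‖M i j‖ ≤ R} =
        Set.pi Set.univ fun _ => Set.pi Set.univ fun _ => Metric.closedBall (0 : ℂ) R := by
      ext M
      exact ⟨fun h i _ j _ => mem_closedBall_zero_iff.2 (h i j),
        fun h i j => mem_closedBall_zero_iff.1 (h i (Set.mem_univ i) j (Set.mem_univ j))⟩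
    rw [this]
    exact isCompact_univ_pi fun _ => isCompact_univ_pi fun _ => isCompact_closedBall _ _
  exact Matrix.SpecialLinearGroup.isClosedEmbedding_val.isCompact_preimage hK

/-- The covering homomorphism is a proper map: `(Λ(A) e₀)⁰ = ½ ∑ |A_{ij}|²` is a proper function
of `A`, and a continuous map into a Hausdorff space whose composite with a continuous function is
proper is itself proper. [folklore] -/
theorem isProperMap_spinCoverHom : IsProperMap spinCoverHom := by
  refine isProperMap_of_comp_of_t2 continuous_spinCoverHom
    Literature.MathematicalPhysics.QuantumLattice.restrictedLorentzGroup.continuous_apply_e₀_zero ?_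
  rw [isProperMap_iff_isCompact_preimage]
  refine ⟨Literature.MathematicalPhysics.QuantumLattice.restrictedLorentzGroup.continuous_apply_e₀_zero.comp continuous_spinCoverHom,
    fun K hK => ?_⟩
  obtain ⟨r, hr⟩ := hK.isBounded.subset_closedBall 0
  refine (isCompact_entry_le (Real.sqrt (2 * |r|))).of_isClosed_subset
    (hK.isClosed.preimage
      (Literature.MathematicalPhysics.QuantumLattice.restrictedLorentzGroup.continuous_apply_e₀_zero.comp continuous_spinCoverHom)) ?_
  intro A hA i j
  have hA' := hr hA
  simp only [Function.comp_apply, Metric.mem_closedBall, dist_zero_right, Real.norm_eq_abs] at hA'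
  change |(spinCoverHom A : Literature.MathematicalPhysics.QuantumLattice.SpaceTime 3 ≃L[ℝ] Literature.MathematicalPhysics.QuantumLattice.SpaceTime 3) (Literature.MathematicalPhysics.QuantumLattice.e₀ 3) 0| ≤ r at hA'
  have h0 : (spinCoverHom A : Literature.MathematicalPhysics.QuantumLattice.SpaceTime 3 ≃L[ℝ] Literature.MathematicalPhysics.QuantumLattice.SpaceTime 3) (Literature.MathematicalPhysics.QuantumLattice.e₀ 3) 0 = spinActFun A (Literature.MathematicalPhysics.QuantumLattice.e₀ 3) 0 := by
    rw [← coe_spinCoverHom]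
  rw [h0, spinActFun_e₀_zero] at hA'
  have hsum : Complex.normSq ((A : Matrix (Fin 2) (Fin 2) ℂ) i j) ≤
      ∑ i, ∑ j, Complex.normSq ((A : Matrix (Fin 2) (Fin 2) ℂ) i j) := by
    have h1 : Complex.normSq ((A : Matrix (Fin 2) (Fin 2) ℂ) i j) ≤
        ∑ j, Complex.normSq ((A : Matrix (Fin 2) (Fin 2) ℂ) i j) :=
      Finset.single_le_sum (f := fun j => Complex.normSq ((A : Matrix (Fin 2) (Fin 2) ℂ) i j))
        (fun j _ => normSq_nonneg _) (Finset.mem_univ j)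
    exact h1.trans (Finset.single_le_sum
      (f := fun i => ∑ j, Complex.normSq ((A : Matrix (Fin 2) (Fin 2) ℂ) i j))
      (fun i _ => Finset.sum_nonneg fun j _ => normSq_nonneg _) (Finset.mem_univ i))
  have h2 : ∑ i, ∑ j, Complex.normSq ((A : Matrix (Fin 2) (Fin 2) ℂ) i j) ≤ 2 * |r| := by
    have h3 := (le_abs_self _).trans hA'
    have h4 := le_abs_self r
    linarith
  calc ‖(A : Matrix (Fin 2) (Fin 2) ℂ) i j‖
        = Real.sqrt (‖(A : Matrix (Fin 2) (Fin 2) ℂ) i j‖ ^ 2) := (Real.sqrt_sq (norm_nonneg _)).symm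
    _ ≤ Real.sqrt (2 * |r|) := Real.sqrt_le_sqrt (by rw [← Complex.normSq_eq_norm_sq]; linarith)

/-! ### Reduction of scalar multiplets to the scalar Wightman axioms -/

namespace IsSpinorWightmanQFT

variable {κ : Type*} {W : SpinorWightmanData κ}

/-- The reduction `IsSpinorWightmanQFT.toWightman`, conditional on the surjectivity of `A ↦ Λ(A)`:
`U(0, −1) = 1` by W2' (with `S = 1`, `Λ(−1) = 1`) and W4, so `U(0, A)` descends along the
covering map to a unitary representation of `L↑₊`, strongly continuous because the covering map is
a (closed, proper) quotient map (Streater–Wightman (1964), §3-1, eqs. (3-1)–(3-4) and example (a),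
the scalar field). [cite: StreaterWightman1964] -/
theorem toWightman_of_surjective (hsurj : spinActFun_surjective) :
    IsSpinorWightmanQFT.toWightman (W := W) := by
  intro hW h hherm
  -- the unique component index of species `k`
  let ι : (k : κ) → Fin (W.mult k) := fun k => Fin.cast (h k).1.symm 0
  have hι : ∀ k (α : Fin (W.mult k)), α = ι k := fun k α => by
    apply Fin.ext
    have h1 := α.2
    have h2 := (ι k).2
    have h3 := (h k).1
    omega
  -- scalar covariance of the single components
  have hcov : ∀ (a : Literature.MathematicalPhysics.QuantumLattice.SpaceTime 3) (A : SL(2, ℂ)) (Λ : Literature.MathematicalPhysics.QuantumLattice.restrictedLorentzGroup 3)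
      (hΛ : ⇑(Λ : Literature.MathematicalPhysics.QuantumLattice.SpaceTime 3 ≃L[ℝ] Literature.MathematicalPhysics.QuantumLattice.SpaceTime 3) = spinActFun A) (k : κ) (f : 𝓢(Literature.MathematicalPhysics.QuantumLattice.SpaceTime 3, ℂ))
      (ψ : W.dom) (hψ : W.U a A ψ ∈ W.dom),
      W.U a A (W.field k (ι k) f ψ : W.H) =
        (W.field k (ι k) (Literature.MathematicalPhysics.QuantumLattice.poincareTest (⟨Multiplicative.ofAdd a, Λ⟩ : Literature.MathematicalPhysics.QuantumLattice.PoincareGroup 3) f)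
          ⟨W.U a A ψ, hψ⟩ : W.H) := by
    intro a A Λ hΛ k f ψ hψ
    have hc := hW.covariant a A Λ hΛ k (ι k) f ψ hψ
    have hS : W.S k A⁻¹ = 1 := by rw [(h k).2.2]; rfl
    rw [hS] at hc
    simpa only [Matrix.one_apply, ite_smul, one_smul, zero_smul, Finset.sum_ite_eq,
      Finset.mem_univ, if_true] using hc
  -- Step 1: `U(0, -1) = 1`
  have hone : ⇑((1 : Literature.MathematicalPhysics.QuantumLattice.restrictedLorentzGroup 3) : Literature.MathematicalPhysics.QuantumLattice.SpaceTime 3 ≃L[ℝ] Literature.MathematicalPhysics.QuantumLattice.SpaceTime 3) =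
      spinActFun (-1) := by
    rw [spinActFun_neg, spinActFun_one]; rfl
  have hP1 : ∀ f : 𝓢(Literature.MathematicalPhysics.QuantumLattice.SpaceTime 3, ℂ),
      Literature.MathematicalPhysics.QuantumLattice.poincareTest (⟨Multiplicative.ofAdd 0, 1⟩ : Literature.MathematicalPhysics.QuantumLattice.PoincareGroup 3) f = f := fun f => by
    ext x
    simp only [Literature.MathematicalPhysics.QuantumLattice.poincareTest_apply, toAdd_ofAdd, sub_zero]
    rfl
  have hVfield : ∀ (k : κ) (f : 𝓢(Literature.MathematicalPhysics.QuantumLattice.SpaceTime 3, ℂ)) (ψ : W.dom),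
      W.U 0 (-1) (W.field k (ι k) f ψ : W.H) =
        (W.field k (ι k) f ⟨W.U 0 (-1) ψ, hW.U_mem_dom 0 (-1) ψ.2⟩ : W.H) := by
    intro k f ψ
    rw [hcov 0 (-1) 1 hone k f ψ (hW.U_mem_dom 0 (-1) ψ.2), hP1]
  have hVmono : ∀ l : List W.Letter,
      W.U 0 (-1) (W.fieldMonomial l W.vacuumDom : W.H) = (W.fieldMonomial l W.vacuumDom : W.H) := by
    intro l
    induction l with
    | nil => simpa using hW.U_vacuum 0 (-1)
    | cons p l ih =>
      obtain ⟨k, α, f⟩ := p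
      have hα := hι k α
      subst hα
      simp only [SpinorWightmanData.fieldMonomial_cons, LinearMap.comp_apply]
      rw [hVfield]
      congr 2
      exact Subtype.ext ih
  have hV1 : W.U 0 (-1) = 1 :=
    ContinuousLinearMap.ext_on hW.cyclic (by
      rintro _ ⟨l, rfl⟩
      simpa using hVmono l)
  have hneg1 : W.spinRep (-1) = 1 := by
    apply Subtype.ext
    have : W.U 0 (-1) = (W.spinRep (-1) : W.H →L[ℂ] W.H) := by
      simp [SpinorWightmanData.U]
    rw [← this, hV1]
    rfl
  -- Step 2: a section of the covering map and the descended representation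
  choose s hs using fun Λ : Literature.MathematicalPhysics.QuantumLattice.restrictedLorentzGroup 3 => hsurj Λ.1 Λ.2
  have hwd : ∀ A B : SL(2, ℂ), spinActFun A = spinActFun B → W.spinRep A = W.spinRep B := by
    intro A B hAB
    rcases (spinActFun_eq_iff_holds A B).1 hAB with rfl | rfl
    · rfl
    · rw [show -B = B * (-1) from (mul_neg_one B).symm, map_mul, hneg1, mul_one]
  let lor : Literature.MathematicalPhysics.QuantumLattice.restrictedLorentzGroup 3 →* unitary (W.H →L[ℂ] W.H) :=
    { toFun := fun Λ => W.spinRep (s Λ)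
      map_one' := by
        have : spinActFun (s 1) = spinActFun 1 := by rw [← hs 1, spinActFun_one]; rfl
        rw [hwd _ _ this, map_one]
      map_mul' := fun Λ₁ Λ₂ => by
        have : spinActFun (s (Λ₁ * Λ₂)) = spinActFun (s Λ₁ * s Λ₂) := by
          rw [spinActFun_mul_holds, ← hs, ← hs, ← hs]; rfl
        rw [hwd _ _ this, map_mul] }
  have lor_apply : ∀ Λ, lor Λ = W.spinRep (s Λ) := fun _ => rfl
  -- monomials of the single components
  let W' : Literature.MathematicalPhysics.QuantumLattice.WightmanData 3 κ :=
    { H := W.H, transl := W.transl, lor := lor, vacuum := W.vacuum, dom := W.dom,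
      vacuum_mem := W.vacuum_mem, field := fun k => W.field k (ι k) }
  have hmono : ∀ l : List W.Letter,
      W.fieldMonomial l = W'.fieldMonomial (l.map fun p => (p.1, p.2.2)) := by
    intro l
    induction l with
    | nil => rfl
    | cons p l ih =>
      obtain ⟨k, α, f⟩ := p
      have hα := hι k α
      subst hα
      rw [SpinorWightmanData.fieldMonomial_cons, List.map_cons, Literature.MathematicalPhysics.QuantumLattice.WightmanData.fieldMonomial_cons, ih]
  have hsurj' : Function.Surjective spinCoverHom := by
    intro Λ
    obtain ⟨A, hA⟩ := hsurj Λ.1 Λ.2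
    refine ⟨A, Subtype.ext (ContinuousLinearEquiv.ext ?_)⟩
    rw [coe_spinCoverHom, ← hA]
  refine ⟨W', ?_, ?_⟩
  · refine
      { strongCont_lor := ?_
        lor_transl := ?_
        spectral := hW.spectral
        uniqueVacuum := hW.uniqueVacuum
        lor_vacuum := fun Λ => hW.spinRep_vacuum _
        norm_vacuum := hW.norm_vacuum
        dense_dom := hW.dense_dom
        transl_dom := hW.transl_dom
        lor_dom := fun Λ ψ hψ => hW.spinRep_dom _ _ hψ
        tempered := fun k ψ χ => hW.tempered k (ι k) ψ χ
        hermitian := fun k f ψ χ => hherm k (ι k) f ψ χ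
        covariant := ?_
        locality := ?_
        cyclic := ?_ }
    · -- W0: strong continuity of the Lorentz part, via the quotient map `SL(2, ℂ) → L↑₊`
      intro ψ
      have hq : IsQuotientMap spinCoverHom :=
        isProperMap_spinCoverHom.isClosedMap.isQuotientMap continuous_spinCoverHom hsurj'
      change Continuous fun Λ : Literature.MathematicalPhysics.QuantumLattice.restrictedLorentzGroup 3 => (W.spinRep (s Λ) : W.H →L[ℂ] W.H) ψ
      rw [hq.continuous_iff]
      have : (fun Λ : Literature.MathematicalPhysics.QuantumLattice.restrictedLorentzGroup 3 => (W.spinRep (s Λ) : W.H →L[ℂ] W.H) ψ) ∘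
          spinCoverHom = fun A => (W.spinRep A : W.H →L[ℂ] W.H) ψ := by
        funext A
        simp only [Function.comp_apply]
        rw [hwd (s (spinCoverHom A)) A (by rw [← hs, coe_spinCoverHom])]
      rw [this]
      exact hW.strongCont_spinRep ψ
    · -- W0: the semidirect-product relation
      intro Λ a
      change (W.spinRep (s Λ) : W.H →L[ℂ] W.H) * W.transl a * (W.spinRep (s Λ⁻¹) : W.H →L[ℂ] W.H)
        = W.transl (Literature.MathematicalPhysics.QuantumLattice.lorentzAct 3 Λ a)
      have hinv : W.spinRep (s Λ⁻¹) = W.spinRep (s Λ)⁻¹ := by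
        rw [map_inv, ← lor_apply, ← lor_apply, map_inv]
      rw [hinv, hW.spin_transl, Literature.MathematicalPhysics.QuantumLattice.lorentzAct_apply, ← hs Λ]
    · -- W2: covariance
      intro g k f ψ hψ
      change W.U g.left.toAdd (s g.right) (W.field k (ι k) f ψ : W.H) =
        (W.field k (ι k) (Literature.MathematicalPhysics.QuantumLattice.poincareTest g f) ⟨W.U g.left.toAdd (s g.right) ψ, hψ⟩ : W.H)
      rw [hcov g.left.toAdd (s g.right) g.right (hs g.right) k f ψ hψ]
      rfl
    · -- W3: locality
      intro k k' f g ψ hsep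
      have := hW.locality k k' (ι k) (ι k') f g ψ hsep
      simpa [(h k).2.1] using this
    · -- W4: cyclicity
      change Dense ((Submodule.span ℂ (Set.range fun l : List (κ × 𝓢(Literature.MathematicalPhysics.QuantumLattice.SpaceTime 3, ℂ)) =>
        (W'.fieldMonomial l W.vacuumDom : W.H))) : Set W.H)
      refine hW.cyclic.mono (Submodule.span_mono ?_)
      rintro _ ⟨l, rfl⟩
      exact ⟨l.map fun p => (p.1, p.2.2), by simp only [hmono l]⟩
  · -- equality of the Wightman functions
    intro n k f
    change ⟪W.vacuum, (W'.fieldMonomial (List.ofFn fun i => (k i, f i)) W.vacuumDom : W.H)⟫_ℂ =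
      ⟪W.vacuum, (W.fieldMonomial (List.ofFn fun i => ⟨k i, ι (k i), f i⟩) W.vacuumDom : W.H)⟫_ℂ
    rw [hmono, List.map_ofFn]
    rfl

/-- **Hermitian scalar multiplets are scalar Wightman fields**: discharge of the named fact
`IsSpinorWightmanQFT.toWightman` (Streater–Wightman (1964), §3-1 with §1-3: for one-component
multiplets with `S(A) = 1` the representation `U(a, A)` of the inhomogeneous `SL(2, ℂ)` descends
to `𝒫↑₊` because `U(0, −1) = 1`, and `A ↦ Λ(A)` is onto `L↑₊` with kernel `{±1}`). [cite: StreaterWightman1964] -/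
theorem toWightman_holds : IsSpinorWightmanQFT.toWightman (W := W) :=
  toWightman_of_surjective spinActFun_surjective_holds

end IsSpinorWightmanQFT

end Literature.Analysis.FunctionSpaces
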